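import Literature.MathematicalPhysics.PowerSystems.DVOCLineDynamics
import Literature.Analysis.ODE.LyapunovSetStabilityDichotomy
import HarnessLib

/-!
# dVOC networks WITH transmission-line dynamics: convergence to the target set `𝒯`
# (Groß–Colombino–Brouillon–Dörfler 2019, Theorem 2 — the attractivity and stability conclusions)

Topic `Literature/MathematicalPhysics/PowerSystems`, namespace
`Literature.MathematicalPhysics.PowerSystems.DvocLines` (the transmission-network record of
`DVOCLineDynamics.lean`, which this file continues). THREE COLUMNS: MODELLED-column mathematics about
the printed full-order model (15) (`N` dVOC-controlled converters as voltage sources, `M` dynamic RL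
lines with uniform `ℓ/r` ratio = Assumption 1, consistent set-points traded for steady-state angles);
no declaration says that a converter, microgrid or grid is stable. 0 named facts: every theorem is
PROVED, from the tree's `DVOCLineDynamics.lean` (Props. 4–7: `ν̇ ≤ −m(ψ² + ‖y_o‖²) − d‖y_n‖²` along
(15), `ν ≥ 0` with zero set `𝒯`) and the tree's a-priori Lyapunov theorem for compact sets
`Literature.Analysis.ODE.DissipativeCurve.*` (= [GrossEtAl2019, Thm. 1], deterministic content).

Source (held, read on the page; `pNNNN` = PDF page of arXiv:1802.08881):
* [GrossEtAl2019] D. Groß, M. Colombino, J.-S. Brouillon, F. Dörfler, *The effect of transmission-line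
  dynamics on grid-forming dispatchable virtual oscillator control*, IEEE TCNS 6 (2019) 1148–1160:
  §IV-A (16) `𝒯`, `𝒯₀ := 𝒯 ∪ {0ₙ}` p0005; **Theorem 2** p0005 L69–L77; §IV-F Prop. 7 (33) and the proof
  of Theorem 2 p0007 L166 – p0008 L44.

> [Thm. 2] «Consider set-points p_k*, q_k*, v_k*, steady-state angles θ_jk*, a stability margin c, and
> control gains α and η, such that Condition 2 holds. Then, the dynamics (15) are almost globally
> asymptotically stable with respect to 𝒯, and the origin 0ₙ is an exponentially unstable
> equilibrium.» (p0005 L69–L78, verbatim)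
> [proof] «We apply Theorem 1 with 𝒞 = 𝒯 and 𝒰 = {0ₙ}. … there exist χ₁, χ₂ ∈ 𝒦∞ such that
> χ₁(‖x‖_𝒯) ≤ ν(x) ≤ χ₂(‖x‖_𝒯) … Proposition 7 guarantees … (d/dt)ν ≤ −χ₃(‖x‖_{𝒯₀}) … It remains to
> show that the region of attraction Z_𝒰 = Z_{0ₙ} has zero Lebesgue measure. …»

## What is proved (every `N ≥ 1`, every `M`, every cycle matrix `C` spanning `ker B` — auxiliary, §12)

Hypotheses = those of the tree's `DvocLines.prop7` (Condition 2 through the bound constants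
`κ₀ ≥ ‖𝒦 − 𝓛‖`, `Υ ≥ ‖𝒴‖`, margin `c`, (23) `DecreaseOnS c`, the gain bound (35)) plus `α > 0`,
`‖Y_l‖ > 0` and `SpansCycles C` (print's `C = B_nᵀ`; positive-definiteness of `W`). For EVERY solution
`x(t) = (v(t), i(t))` of (15) on `[0, ∞)` (`IsSolutionOn γ (Ici 0)`):
* `isCompact_target`, `isCompact_nu_sublevel` — `𝒯` is compact and every sublevel set of `ν` (32) is
  compact («radially unbounded w.r.t. 𝒯», the `𝒦∞` bounds of the printed proof);
* `rate_eq_zero_iff` — the dissipation rate of Prop. 7 vanishes exactly on `𝒯₀ = 𝒯 ∪ {0}`;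
* `dissipativeCurve` — a solution of (15) is a `DissipativeCurve` for `ν` in its own sublevel set;
* **`tendsto_infDist_target_or_tendsto_zero`** — THE DICHOTOMY: `dist(x(t), 𝒯) → 0` or `x(t) → 0`
  («(15) … asymptotically stable with respect to 𝒯» for every initial state outside the region of
  attraction of the origin — the deterministic content of «almost globally»);
* **`tendsto_infDist_target_of_nu_lt`** — the explicit REGION OF ATTRACTION `{ν < ν(0)}`:
  `ν(x(0)) < ν(0ₙ) = (1 − d)·½ηαα₁Σ_k v_k*²` forces `dist(x(t), 𝒯) → 0`;
* **`target_stable`** — `𝒯` is Lyapunov stable, uniformly over solutions («𝒞 is Lyapunov stable»);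
* `tendsto_rate_zero`, `tendsto_dev`, `tendsto_normS2` — along EVERY solution the rate dies out,
  the line currents lock onto their quasi-steady state, `i(t) − i^s(v(t)) → 0`, and the phase error
  `‖v(t)‖²_S → 0` (Salvadori's theorem on `ν`);
* `tendsto_infDist_target_of_condition2` — the dichotomy and the region of attraction under
  Condition 2 AS PRINTED (`N ≥ 2`; hypotheses of the tree's `nu_le_nu_zero_of_condition2`);
* §8 (append): `contDiff_fullField`, `contDiff_nu`, `fderiv_nu_fullField`, **`exists_isSolutionOn`** —
  from EVERY initial state a solution of (15) on `[0, ∞)` exists (the statements above are not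
  vacuous);
* §9 (append): `fullField_zero`, `isSolutionOn_zero`, `infDist_zero_target_pos` — `0ₙ` is an
  equilibrium, the rest solution realises the alternative «x(t) → 0ₙ» and stays at positive distance
  from `𝒯`;
* §10 (append): `isSolutionOn_unique`, `existsUnique_isSolutionOn` — from every initial state EXACTLY
  ONE solution of (15) on `[0, ∞)` (Grönwall on the compact invariant sublevel set);
* §11 (append): `DvocReduced.V_embS`, `nu_iss`, `nu_embS_iss_lt_nu_zero`,
  `tendsto_infDist_target_of_embS_iss`, **`origin_unstable'`**, **`origin_unstable`** — the origin `0ₙ`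
  is an UNSTABLE equilibrium of (15) in Lyapunov's sense: every ball around `0ₙ` contains states
  `(S(a,0), i^s(S(a,0)))` below the level `ν(0ₙ)`, and ALL solutions issued from them converge to `𝒯`
  and leave the ball of radius `dist(0ₙ, 𝒯)/2` (the printed «ν₀(0ₙ) > ν₀(x₀) for x₀ = (v₀, i^s(v₀)),
  v₀ ∈ 𝒮 ∖ {0}» argument, run on `ν` and the nonlinear model instead of the linearisation);
* §12 (append): `incMap`, `cycleSpace`, **`exists_isCycle_spansCycles`** — a cycle matrix `C` with
  `IsCycle C ∧ SpansCycles C` (rows = a basis of `ker B`, the printed `B_nᵀ`) EXISTS for every network,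
  so the cycle-matrix hypotheses are auxiliary: **`thm2_dichotomy`**, `thm2_target_stable`,
  `thm2_tendsto_dev`, `thm2_tendsto_normS2`, `thm2_existsUnique_isSolutionOn`, `thm2_origin_unstable'`,
  `thm2_origin_unstable` restate §§5–11 under the hypotheses on the network and control data alone;
* §13 (append): `core_of_proposition2`, **`prop2_dichotomy`**, `prop2_target_stable`,
  `prop2_tendsto_dev_and_normS2`, `prop2_existsUnique_isSolutionOn`, `prop2_origin_unstable` —
  Theorem 2's typed conclusions under PROPOSITION 2'S PRINTED POWER-FLOW HYPOTHESES (every `N ≥ 2`,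
  every `M`; `κ = tan⁻¹(ρω₀)`; branch powers `p_jk*`, `q_jk*`, set-point bounds, `|θ_jk*| ≤ π/2`,
  `Σ_j‖Y_jk‖ ≤ d`, `‖K_k‖ ≤ κ_K`, `η < c/(2ρd(c + 5κ_K + 10d))`, one variational `λ ≤ λ₂(L)`
  certificate): no operator norm, no cycle matrix, no PSD certificate left;
* §14 (append): `DvocReduced.lam_of_complete` — for a COMPLETE converter graph (every pair joined by a
  line, as in the printed three-bus case) with weights `≥ w_min` the `λ₂` certificate holds with
  `λ = N·w_min`, so there Theorem 2's hypotheses are closed-form inequalities on the data;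
* §15 (append): `fullField_eq_zero_iff` — the equilibria of (15) are EXACTLY `𝒯 ∪ {0ₙ}` (corollary of
  the dichotomy: no rest point outside the desired synchronous states and the origin);
* §16 (append): `tendsto_nsq_of_tendsto_infDist_target`, **`thm2_objectives`** — the dichotomy in
  the words of §II-C: every solution tends to `0ₙ` or achieves voltage regulation `‖v_k‖² → v_k*²`,
  phase synchronisation `‖v‖²_S → 0` and locked line currents.

## Not here (deliberately) — what of the printed Theorem 2 is NOT typed

(i) «almost»: the measure-zero statement about the region of attraction of `0ₙ` (stable-manifold
theorem via the hyperbolicity argument of p0008 L1–L44); (ii) the word «exponentially» in «the origin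
0ₙ is an exponentially unstable equilibrium» of (15) (p0005 L77–L78, p0008 L23–L40: at least one
eigenvalue of the linearisation `A₀` of (15) at `0ₙ` has positive real part — a spectral statement; the
tree's `DvocReduced.hasFDerivAt_field_zero` / `jac0_embS` / `ray_exp_growth` give the unstable
directions and the exponentially growing ray solutions of the REDUCED field (17) only). Instability of
`0ₙ` for (15) in Lyapunov's sense IS typed (§11). What IS typed of Theorem 2: the attractivity
dichotomy, the sublevel region of attraction, the Lyapunov stability of `𝒯` and the instability of
`0ₙ`, for solutions on `[0, ∞)` (which exist, uniquely, from every initial state, §8/§10). Existence of solutions of (15) from every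
initial state is not asserted here (the field is polynomial, every sublevel set of `ν` is compact and
invariant; cf. `Literature.Analysis.ODE.exists_global_solution_of_sublevel`) — SUPERSEDED by the
§8 append: `exists_isSolutionOn`.
-/

noncomputable section

namespace Literature.MathematicalPhysics.PowerSystems

open Real Finset Set Filter Metric
open scoped _root_.Topology
open Literature.Analysis.ODE

/-! ## §1 Continuity of the printed objects (all polynomial, `ψ` with square roots) -/

namespace DvocReduced

variable {N : ℕ} (W : DvocReduced N)

/-- `‖v‖²_S` (the projector form of (19)) is continuous (Summits-side twin, not importable into
Literature: `Summit.Ventures.GridStability.Lyapunov.DvocReducedRoa.continuous_normS2`).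
[cite: GrossEtAl2019, eq. (19)] -/
theorem continuous_normS2 : Continuous W.normS2 := by
  unfold normS2 qS sig₁ sig₂ dvocDot; fun_prop

/-- The reduced Lyapunov function `V` (19) is continuous (Summits-side twin:
`Summit.Ventures.GridStability.Lyapunov.DvocReducedRoa.continuous_V`). [cite: GrossEtAl2019, eq. (19)] -/
theorem continuous_V (α₁ : ℝ) : Continuous (W.V α₁) := by
  unfold V normS2 qS sig₁ sig₂ dvocDot dvocNsq; fun_prop

/-- The comparison function `ψ` (21) is continuous (Summits-side twin:
`Summit.Ventures.GridStability.Lyapunov.DvocReducedRoa.continuous_psi`). [cite: GrossEtAl2019, eq. (21)] -/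
theorem continuous_psi (κ₀ : ℝ) : Continuous (W.psi κ₀) := by
  have h1 := W.continuous_normS2
  have h2 : Continuous fun v : DvocState N => ∑ k, W.Phi v k ^ 2 * dvocNsq v k := by
    unfold Phi dvocNsq; fun_prop
  unfold psi; fun_prop

end DvocReduced

namespace DvocLines

variable {N M : ℕ} (E : DvocLines N M) (W : DvocReduced N)

/-- `i^s` (Definition 1) is continuous (linear). [cite: GrossEtAl2019, Definition 1] -/
theorem continuous_iss : Continuous E.iss := by
  unfold iss iss₁ iss₂ dV₁ dV₂; fun_prop

/-- The full-order field (15) is continuous (polynomial). [cite: GrossEtAl2019, eq. (15)] -/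
theorem continuous_fullField : Continuous (E.fullField W) := by
  unfold fullField fvVec fv₁ fv₂ fiVec fi₁ fi₂ DvocReduced.Kang₁ DvocReduced.Kang₂ DvocReduced.Phi
    dvocNsq nodeCur₁ nodeCur₂ dV₁ dV₂
  fun_prop

section convergence

variable {M₀ : ℕ} (C : Fin M₀ → Fin M → ℝ)

/-- `‖y_o‖²` is continuous. [cite: GrossEtAl2019, eq. (31)] -/
theorem continuous_normYoSq : Continuous E.normYoSq := by
  unfold normYoSq dvocNsq nodeCur nodeCur₁ nodeCur₂; fun_prop

/-- `‖y_n‖²` is continuous. [cite: GrossEtAl2019, eq. (31)] -/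
theorem continuous_normYnSq : Continuous (E.normYnSq C) := by
  unfold normYnSq cyc₁ cyc₂; fun_prop

/-- The composite Lyapunov function `ν` (32) is continuous. [cite: GrossEtAl2019, eq. (32)] -/
theorem continuous_nu (d α₁ : ℝ) : Continuous (E.nu W C d α₁) := by
  have h1 := E.continuous_normYoSq
  have h2 := E.continuous_normYnSq C
  have h3 := W.continuous_V α₁
  have h4 := E.continuous_iss
  unfold nu Wfun dev; fun_prop

/-! ## §2 The dissipation rate of Proposition 7 and its zero set `𝒯₀ = 𝒯 ∪ {0}` -/

/-- The right-hand side of Prop. 7 as a function of the state: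
`D(x) := m (ψ(v)² + ‖y_o‖²) + d ‖y_n‖²`, `y = i − i^s(v)` (print: `−χ₃(‖x‖_{𝒯₀})`; tree `prop7`:
`m = mLB`, `d = dWeight`). [cite: GrossEtAl2019, Prop. 7 (33)] -/
def rate (m d κ₀ : ℝ) (x : DvocState N × LineState M) : ℝ :=
  m * (W.psi κ₀ x.1 ^ 2 + E.normYoSq (E.dev x.1 x.2)) + d * E.normYnSq C (E.dev x.1 x.2)

/-- The rate is continuous. [cite: GrossEtAl2019, Prop. 7 (33)] -/
theorem continuous_rate (m d κ₀ : ℝ) : Continuous (E.rate W C m d κ₀) := by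
  have h1 := E.continuous_normYoSq
  have h2 := E.continuous_normYnSq C
  have h3 := W.continuous_psi κ₀
  have h4 := E.continuous_iss
  unfold rate dev; fun_prop

/-- The rate is nonnegative for `m, d ≥ 0`. [cite: GrossEtAl2019, Prop. 7 (33)] -/
theorem rate_nonneg {m d : ℝ} (hm : 0 ≤ m) (hd : 0 ≤ d) (κ₀ : ℝ) (x : DvocState N × LineState M) :
    0 ≤ E.rate W C m d κ₀ x := by
  unfold rate
  have := E.normYoSq_nonneg (E.dev x.1 x.2)
  have := E.normYnSq_nonneg C (E.dev x.1 x.2)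
  positivity

/-- `i^s(0) = 0`. [cite: GrossEtAl2019, Definition 1] -/
theorem iss_zero : E.iss (0 : DvocState N) = 0 := by
  refine Prod.ext (funext fun l => ?_) (funext fun l => ?_) <;> simp [iss, iss₁, iss₂, dV₁, dV₂]

/-- **Zero set of the rate is `𝒯₀ = 𝒯 ∪ {0}`** («(d/dt)ν(x) < 0 for all (v, i) ∉ 𝒯₀»): for
`m, d > 0`, gains `η, α > 0`, `κ₀ > 0`, set-points `v_k* > 0`, `ρ > 0` and the injectivity of
`y ↦ (ℬy, B_nᵀL_T y)` (Prop. 4), `D(x) = 0 ↔ x ∈ 𝒯 ∨ x = 0`. [cite: GrossEtAl2019, Prop. 7 (proof)] -/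
theorem rate_eq_zero_iff [NeZero N] (hη : 0 < W.η) (hα : 0 < W.α) {κ₀ : ℝ} (hκ₀ : 0 < κ₀)
    (hv : ∀ k, 0 < W.vref k) (hρ : 0 < E.ρ)
    (hinj : ∀ y : LineState M, E.nodeCur y = 0 → (∀ c, E.cyc₁ C y c = 0 ∧ E.cyc₂ C y c = 0) → y = 0)
    {m d : ℝ} (hm : 0 < m) (hd : 0 < d) (x : DvocState N × LineState M) :
    E.rate W C m d κ₀ x = 0 ↔ E.InT W x ∨ x = 0 := by
  have hYo := E.normYoSq_nonneg (E.dev x.1 x.2)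
  have hYn := E.normYnSq_nonneg C (E.dev x.1 x.2)
  have hψ2 := sq_nonneg (W.psi κ₀ x.1)
  constructor
  · intro h0
    unfold rate at h0
    have hA : 0 ≤ m * (W.psi κ₀ x.1 ^ 2 + E.normYoSq (E.dev x.1 x.2)) := by positivity
    have hB : 0 ≤ d * E.normYnSq C (E.dev x.1 x.2) := by positivity
    have hA0 : W.psi κ₀ x.1 ^ 2 + E.normYoSq (E.dev x.1 x.2) = 0 := by
      have : m * (W.psi κ₀ x.1 ^ 2 + E.normYoSq (E.dev x.1 x.2)) = 0 := by linarith
      rcases mul_eq_zero.1 this with h | h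
      · exact absurd h hm.ne'
      · exact h
    have hB0 : E.normYnSq C (E.dev x.1 x.2) = 0 := by
      have : d * E.normYnSq C (E.dev x.1 x.2) = 0 := by linarith
      rcases mul_eq_zero.1 this with h | h
      · exact absurd h hd.ne'
      · exact h
    have hψ : W.psi κ₀ x.1 = 0 := (pow_eq_zero_iff two_ne_zero).1 (by linarith)
    have ho : E.normYoSq (E.dev x.1 x.2) = 0 := by linarith
    have hn : E.normYnSq C (E.dev x.1 x.2) = 0 := hB0
    have hW : E.Wfun C (E.dev x.1 x.2) = 0 := by simp [Wfun, ho, hn]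
    have hy : E.dev x.1 x.2 = 0 := (E.Wfun_eq_zero_iff C hρ hinj _).1 hW
    have hi : x.2 = E.iss x.1 := by simpa [dev, sub_eq_zero] using hy
    rcases (W.psi_eq_zero_iff hη hα hκ₀ hv x.1).1 hψ with ⟨hS, hA⟩ | h0
    · exact Or.inl ⟨hS, hA, hi⟩
    · right
      refine Prod.ext h0 ?_
      rw [hi, h0, E.iss_zero]; rfl
  · rintro (hT | rfl)
    · obtain ⟨hS, hA, hi⟩ := hT
      have hψ : W.psi κ₀ x.1 = 0 := (W.psi_eq_zero_iff hη hα hκ₀ hv x.1).2 (Or.inl ⟨hS, hA⟩)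
      have hy : E.dev x.1 x.2 = 0 := by simp [dev, hi]
      have hW := (E.Wfun_eq_zero_iff C hρ hinj (E.dev x.1 x.2)).2 hy
      have hsum : E.normYoSq (E.dev x.1 x.2) + E.normYnSq C (E.dev x.1 x.2) = 0 := by
        unfold Wfun at hW
        rcases mul_eq_zero.1 hW with h | h
        · exact absurd h (by positivity)
        · exact h
      have ho : E.normYoSq (E.dev x.1 x.2) = 0 := by linarith
      have hn : E.normYnSq C (E.dev x.1 x.2) = 0 := by linarith
      unfold rate
      rw [hψ, ho, hn]; ring
    · have hψ : W.psi κ₀ (0 : DvocState N) = 0 :=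
        (W.psi_eq_zero_iff hη hα hκ₀ hv _).2 (Or.inr rfl)
      have hy : E.dev (0 : DvocState N) (0 : LineState M) = 0 := by
        show (0 : LineState M) - E.iss 0 = 0
        rw [E.iss_zero, sub_zero]
      have hW := (E.Wfun_eq_zero_iff C hρ hinj _).2 hy
      have hsum : E.normYoSq (E.dev (0 : DvocState N) (0 : LineState M))
          + E.normYnSq C (E.dev (0 : DvocState N) (0 : LineState M)) = 0 := by
        unfold Wfun at hW
        rcases mul_eq_zero.1 hW with h | h
        · exact absurd h (by positivity)
        · exact h
      have ho : E.normYoSq (E.dev (0 : DvocState N) (0 : LineState M)) = 0 := by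
        have := E.normYoSq_nonneg (E.dev (0 : DvocState N) (0 : LineState M))
        have := E.normYnSq_nonneg C (E.dev (0 : DvocState N) (0 : LineState M))
        linarith
      have hn : E.normYnSq C (E.dev (0 : DvocState N) (0 : LineState M)) = 0 := by linarith
      show m * (W.psi κ₀ (0 : DvocState N) ^ 2 + E.normYoSq (E.dev (0 : DvocState N) (0 : LineState M)))
          + d * E.normYnSq C (E.dev (0 : DvocState N) (0 : LineState M)) = 0
      rw [hψ, ho, hn]; ring

/-! ## §3 The target set `𝒯` is compact; `ν` at the origin -/

/-- The target set (16) as a subset of the state space. [cite: GrossEtAl2019, eq. (16)] -/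
def target : Set (DvocState N × LineState M) := {x | E.InT W x}

/-- `𝒯` is the image of the unit circle under `(a, b) ↦ (S(a,b), i^s(S(a,b)))` (all `v_k* ≠ 0`,
`N ≥ 1`). [cite: GrossEtAl2019, eq. (16)] -/
theorem target_eq_image [NeZero N] (hv : ∀ k, W.vref k ≠ 0) :
    E.target W = (fun p : ℝ × ℝ => (W.embS p.1 p.2, E.iss (W.embS p.1 p.2))) ''
      {p : ℝ × ℝ | p.1 ^ 2 + p.2 ^ 2 = 1} := by
  ext x
  constructor
  · rintro ⟨⟨a, b, hab⟩, hA, hi⟩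
    refine ⟨(a, b), ?_, ?_⟩
    · have h0 := hA (0 : Fin N)
      rw [hab, W.nsq_embS] at h0
      have hv0 : W.vref 0 ^ 2 ≠ 0 := pow_ne_zero 2 (hv 0)
      show a ^ 2 + b ^ 2 = 1
      have : W.vref 0 ^ 2 * (a ^ 2 + b ^ 2 - 1) = 0 := by linarith
      rcases mul_eq_zero.1 this with h | h
      · exact absurd h hv0
      · linarith
    · refine Prod.ext ?_ ?_
      · exact hab.symm
      · show E.iss (W.embS a b) = x.2
        rw [hi, hab]
  · rintro ⟨p, hp, rfl⟩
    have hp' : p.1 ^ 2 + p.2 ^ 2 = 1 := hp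
    refine ⟨⟨p.1, p.2, rfl⟩, fun k => ?_, rfl⟩
    show dvocNsq (W.embS p.1 p.2) k = W.vref k ^ 2
    rw [W.nsq_embS, hp', mul_one]

/-- **`𝒯` is compact** («𝒮 ∩ 𝒜 is a compact set», lifted by the continuous `i^s`).
[cite: GrossEtAl2019, §IV-A (16) / proof of Prop. 3] -/
theorem isCompact_target [NeZero N] (hv : ∀ k, W.vref k ≠ 0) : IsCompact (E.target W) := by
  rw [E.target_eq_image W hv]
  refine IsCompact.image ?_ ?_
  · refine Metric.isCompact_of_isClosed_isBounded (isClosed_eq (by fun_prop) continuous_const) ?_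
    refine (Metric.isBounded_closedBall (x := (0 : ℝ × ℝ)) (r := 1)).subset fun p hp => ?_
    have hp' : p.1 ^ 2 + p.2 ^ 2 = 1 := hp
    rw [mem_closedBall, dist_zero_right, Prod.norm_def, max_le_iff, Real.norm_eq_abs,
      Real.norm_eq_abs]
    constructor <;> nlinarith [sq_nonneg p.1, sq_nonneg p.2, abs_nonneg p.1, abs_nonneg p.2,
      sq_abs p.1, sq_abs p.2]
  · have hS : Continuous fun p : ℝ × ℝ => W.embS p.1 p.2 := by
      unfold DvocReduced.embS; fun_prop
    exact hS.prodMk (E.continuous_iss.comp hS)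

/-- **`ν` at the origin**: `ν(0ₙ) = (1 − d) V(0) = (1 − d)·½ηαα₁Σ_k v_k*²` (`i^s(0) = 0`, `W(0) = 0`).
[cite: GrossEtAl2019, eq. (32), (19)] -/
theorem nu_zero (d α₁ : ℝ) :
    E.nu W C d α₁ 0 = (1 - d) * (1 / 2 * W.η * W.α * α₁ * W.Lam) := by
  have hdev : E.dev (0 : DvocState N × LineState M).1 (0 : DvocState N × LineState M).2 = 0 := by
    show (0 : LineState M) - E.iss 0 = 0
    rw [E.iss_zero, sub_zero]
  have hW : E.Wfun C (0 : LineState M) = 0 := by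
    simp [Wfun, normYoSq, normYnSq, nodeCur, nodeCur₁, nodeCur₂, cyc₁, cyc₂, dvocNsq]
  rw [nu, hdev, hW, mul_zero, zero_add]
  exact congrArg _ (W.V_zero α₁)

/-! ## §4 Every sublevel set of `ν` is compact (coercivity of `W` from injectivity) -/

/-- `‖y_o‖²` is quadratic: `‖ℬ(c y)‖² = c² ‖ℬ y‖²`. [cite: GrossEtAl2019, eq. (31)] -/
theorem normYoSq_smul (c : ℝ) (y : LineState M) : E.normYoSq (c • y) = c ^ 2 * E.normYoSq y := by
  simp only [normYoSq, dvocNsq, nodeCur, nodeCur₁, nodeCur₂, Prod.smul_fst, Prod.smul_snd,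
    Pi.smul_apply, smul_eq_mul, Finset.mul_sum]
  exact Finset.sum_congr rfl fun k _ => by
    rw [show (∑ l, E.inc k l * (c * y.1 l)) = c * ∑ l, E.inc k l * y.1 l by
        rw [Finset.mul_sum]; exact Finset.sum_congr rfl fun l _ => by ring,
      show (∑ l, E.inc k l * (c * y.2 l)) = c * ∑ l, E.inc k l * y.2 l by
        rw [Finset.mul_sum]; exact Finset.sum_congr rfl fun l _ => by ring]
    ring

/-- `‖y_n‖²` is quadratic. [cite: GrossEtAl2019, eq. (31)] -/
theorem normYnSq_smul (c : ℝ) (y : LineState M) :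
    E.normYnSq C (c • y) = c ^ 2 * E.normYnSq C y := by
  simp only [normYnSq, cyc₁, cyc₂, Prod.smul_fst, Prod.smul_snd, Pi.smul_apply, smul_eq_mul,
    Finset.mul_sum]
  exact Finset.sum_congr rfl fun k _ => by
    rw [show (∑ l, C k l * E.ind l * (c * y.1 l)) = c * ∑ l, C k l * E.ind l * y.1 l by
        rw [Finset.mul_sum]; exact Finset.sum_congr rfl fun l _ => by ring,
      show (∑ l, C k l * E.ind l * (c * y.2 l)) = c * ∑ l, C k l * E.ind l * y.2 l by
        rw [Finset.mul_sum]; exact Finset.sum_congr rfl fun l _ => by ring]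
    ring

/-- **Coercivity of the quadratic form of `W`** («Because B_n has full rank … W(y) is positive
definite»): under the injectivity of `y ↦ (ℬy, B_nᵀL_T y)` (and `ρ > 0`) there is `μ > 0` with
`μ‖y‖² ≤ ‖y_o‖² + ‖y_n‖²` for all `y` — the quantitative form (minimum on the compact unit sphere,
homogeneity) behind the `𝒦∞` lower bound `χ₁^W` of Prop. 4. [cite: GrossEtAl2019, Prop. 4] -/
theorem exists_coercive (hρ : 0 < E.ρ)
    (hinj : ∀ y : LineState M, E.nodeCur y = 0 → (∀ c, E.cyc₁ C y c = 0 ∧ E.cyc₂ C y c = 0) → y = 0) :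
    ∃ μ > 0, ∀ y : LineState M, μ * ‖y‖ ^ 2 ≤ E.normYoSq y + E.normYnSq C y := by
  set Q : LineState M → ℝ := fun y => E.normYoSq y + E.normYnSq C y with hQ
  have hQc : Continuous Q := (E.continuous_normYoSq).add (E.continuous_normYnSq C)
  have hQpos : ∀ y, y ≠ 0 → 0 < Q y := by
    intro y hy
    have hnn : 0 ≤ Q y := add_nonneg (E.normYoSq_nonneg y) (E.normYnSq_nonneg C y)
    refine lt_of_le_of_ne hnn fun h0 => hy ?_
    have hsum : E.normYoSq y + E.normYnSq C y = 0 := by simpa [hQ] using h0.symm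
    have hW : E.Wfun C y = 0 := by unfold Wfun; rw [hsum, mul_zero]
    exact (E.Wfun_eq_zero_iff C hρ hinj y).1 hW
  have hQsmul : ∀ (c : ℝ) (y : LineState M), Q (c • y) = c ^ 2 * Q y := fun c y => by
    simp only [hQ, E.normYoSq_smul, E.normYnSq_smul C]; ring
  set S : Set (LineState M) := sphere 0 1 with hS
  have hSc : IsCompact S := isCompact_sphere 0 1
  rcases S.eq_empty_or_nonempty with hemp | hne
  · refine ⟨1, one_pos, fun y => ?_⟩
    by_cases hy : y = 0
    · subst hy
      rw [norm_zero, zero_pow two_ne_zero, mul_zero]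
      exact add_nonneg (E.normYoSq_nonneg 0) (E.normYnSq_nonneg C 0)
    · exfalso
      have hn : ‖y‖ ≠ 0 := norm_ne_zero_iff.2 hy
      have hmem : ‖y‖⁻¹ • y ∈ S := by
        rw [hS, mem_sphere_zero_iff_norm, norm_smul, norm_inv, norm_norm, inv_mul_cancel₀ hn]
      rw [hemp] at hmem
      exact hmem
  · obtain ⟨u₀, hu₀, hmin⟩ := hSc.exists_isMinOn hne hQc.continuousOn
    have hu₀ne : u₀ ≠ 0 := by
      intro h; rw [h, hS, mem_sphere_zero_iff_norm, norm_zero] at hu₀; exact zero_ne_one hu₀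
    refine ⟨Q u₀, hQpos u₀ hu₀ne, fun y => ?_⟩
    by_cases hy : y = 0
    · subst hy
      rw [norm_zero, zero_pow two_ne_zero, mul_zero]
      exact add_nonneg (E.normYoSq_nonneg 0) (E.normYnSq_nonneg C 0)
    · have hn : ‖y‖ ≠ 0 := norm_ne_zero_iff.2 hy
      have hmem : ‖y‖⁻¹ • y ∈ S := by
        rw [hS, mem_sphere_zero_iff_norm, norm_smul, norm_inv, norm_norm, inv_mul_cancel₀ hn]
      have hle : Q u₀ ≤ Q (‖y‖⁻¹ • y) := hmin hmem
      rw [hQsmul] at hle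
      have hpos : 0 < ‖y‖ ^ 2 := by positivity
      calc Q u₀ * ‖y‖ ^ 2 ≤ ‖y‖⁻¹ ^ 2 * Q y * ‖y‖ ^ 2 := by gcongr
        _ = Q y := by field_simp

/-- **Every sublevel set `{ν ≤ c}` is compact** («radially unbounded with respect to 𝒯»; the `𝒦∞`
lower bound `χ₁(‖x‖_𝒯) ≤ ν(x)` of the proof of Thm. 2): `V ≤ c/(1−d)` confines every `‖v_k‖`
(tree `DvocReduced.nsq_le_of_V_le`), `W ≤ c/d` confines `y = i − i^s(v)` by `exists_coercive`, and
`(v, y) ↦ (v, y + i^s(v))` is continuous. Needs `0 < d < 1`, `ηαα₁ > 0`, `v_k* > 0`, `ρ > 0` and the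
injectivity of Prop. 4. [cite: GrossEtAl2019, proof of Thm. 2] -/
theorem isCompact_nu_sublevel [NeZero N] (hv : ∀ k, 0 < W.vref k) (hρ : 0 < E.ρ)
    (hinj : ∀ y : LineState M, E.nodeCur y = 0 → (∀ c, E.cyc₁ C y c = 0 ∧ E.cyc₂ C y c = 0) → y = 0)
    {d α₁ : ℝ} (hd0 : 0 < d) (hd1 : d < 1) (hw : 0 < W.η * W.α * α₁) (c : ℝ) :
    IsCompact {x : DvocState N × LineState M | E.nu W C d α₁ x ≤ c} := by
  have hΛ : W.Lam ≠ 0 := (W.Lam_pos hv).ne'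
  obtain ⟨μ, hμ, hcoer⟩ := E.exists_coercive C hρ hinj
  -- radii
  set s : ℝ := Real.sqrt (2 * (c / (1 - d)) / (W.η * W.α * α₁)) with hs
  set B : ℝ := ∑ j, (W.vref j ^ 2 + s * |W.vref j|) with hB
  have hB0 : 0 ≤ B := Finset.sum_nonneg fun j _ => by positivity
  set R₁ : ℝ := Real.sqrt B with hR₁
  set R₂ : ℝ := Real.sqrt (2 * (c / d) / E.ρ / μ) with hR₂
  -- the continuous reparametrisation `(v, y) ↦ (v, y + i^s(v))`
  set Φ : DvocState N × LineState M → DvocState N × LineState M :=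
    fun p => (p.1, p.2 + E.iss p.1) with hΦ
  have hΦc : Continuous Φ := by have := E.continuous_iss; simp only [hΦ]; fun_prop
  have hKc : IsCompact (Φ '' (closedBall (0 : DvocState N) R₁ ×ˢ closedBall (0 : LineState M) R₂)) :=
    ((isCompact_closedBall 0 R₁).prod (isCompact_closedBall 0 R₂)).image hΦc
  refine hKc.of_isClosed_subset (isClosed_le (E.continuous_nu W C d α₁) continuous_const) ?_
  intro x hx
  have hx' : E.nu W C d α₁ x ≤ c := hx
  have hWnn := E.Wfun_nonneg C hρ.le (E.dev x.1 x.2)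
  have hVnn := W.V_nonneg hΛ hw.le x.1
  -- `V ≤ c/(1-d)` and `W ≤ c/d`
  have hV : W.V α₁ x.1 ≤ c / (1 - d) := by
    rw [le_div_iff₀ (by linarith)]; unfold nu at hx'; nlinarith
  have hWle : E.Wfun C (E.dev x.1 x.2) ≤ c / d := by
    rw [le_div_iff₀ hd0]; unfold nu at hx'; nlinarith
  refine ⟨(x.1, E.dev x.1 x.2), ⟨?_, ?_⟩, ?_⟩
  · -- voltages
    rw [mem_closedBall, dist_zero_right]
    have hk : ∀ k, dvocNsq x.1 k ≤ B := fun k => by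
      have h1 := W.nsq_le_of_V_le hΛ hw hV (hv k).ne'
      have h2 : W.vref k ^ 2 + s * |W.vref k| ≤ B :=
        Finset.single_le_sum (f := fun j => W.vref j ^ 2 + s * |W.vref j|)
          (fun j _ => by positivity) (Finset.mem_univ k)
      exact h1.trans h2
    have h1 : ∀ k, |x.1.1 k| ≤ R₁ := fun k =>
      Real.abs_le_sqrt (by have := hk k; unfold dvocNsq at this; nlinarith [sq_nonneg (x.1.2 k)])
    have h2 : ∀ k, |x.1.2 k| ≤ R₁ := fun k =>
      Real.abs_le_sqrt (by have := hk k; unfold dvocNsq at this; nlinarith [sq_nonneg (x.1.1 k)])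
    have hR : 0 ≤ R₁ := Real.sqrt_nonneg _
    rw [Prod.norm_def, max_le_iff, pi_norm_le_iff_of_nonneg hR, pi_norm_le_iff_of_nonneg hR]
    exact ⟨fun k => by rw [Real.norm_eq_abs]; exact h1 k,
      fun k => by rw [Real.norm_eq_abs]; exact h2 k⟩
  · -- current deviations
    rw [mem_closedBall, dist_zero_right]
    have hQ : E.normYoSq (E.dev x.1 x.2) + E.normYnSq C (E.dev x.1 x.2) ≤ 2 * (c / d) / E.ρ := by
      rw [le_div_iff₀ hρ]; unfold Wfun at hWle; nlinarith
    have hsq : ‖E.dev x.1 x.2‖ ^ 2 ≤ 2 * (c / d) / E.ρ / μ := by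
      rw [le_div_iff₀ hμ]
      have := hcoer (E.dev x.1 x.2)
      nlinarith
    exact Real.le_sqrt_of_sq_le hsq
  · simp only [hΦ, dev, sub_add_cancel]

/-! ## §5 A solution of (15) is a dissipative curve for `ν`; the conclusions of Theorem 2 -/

/-- `0 < d < 1` for the printed weight `d = 1/(1 + κ₀ρΥ)` (`κ₀, ρ, Υ > 0`).
[cite: GrossEtAl2019, Prop. 7 («d ∈ ℝ_{(0,1)}»)] -/
theorem dWeight_mem_Ioo (hρ : 0 < E.ρ) {κ₀ Υ : ℝ} (hκ₀ : 0 < κ₀) (hΥ : 0 < Υ) :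
    E.dWeight κ₀ Υ ∈ Ioo (0 : ℝ) 1 := by
  unfold dWeight
  have : 0 < κ₀ * E.ρ * Υ := by positivity
  constructor
  · positivity
  · rw [div_lt_one (by positivity)]; linarith

/-- **A solution of (15) on `[0, ∞)` is a `DissipativeCurve`** for `ν` (32) with the rate of Prop. 7,
inside the sublevel set `{ν ≤ ν(x(0))}` (Prop. 7 along the solution; `ν` non-increasing, tree
`nu_antitoneOn`). Hypotheses = those of the tree's `prop7`.
[cite: GrossEtAl2019, Prop. 7 / proof of Thm. 2] -/
theorem dissipativeCurve [NeZero N] (h : E.Consistent W) (hC : E.IsCycle C) (hρ : 0 < E.ρ)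
    (ha : ∀ l, E.a l ≠ 0) (hη : 0 < W.η) (hα : 0 ≤ W.α) (hv : ∀ k, 0 < W.vref k)
    {c κ₀ Υ : ℝ} (hc : 0 < c) (hκ₀ : 0 < κ₀) (hcκ : c ≤ κ₀) (hΥ : 0 < Υ)
    (h23 : W.DecreaseOnS c) (hK : W.PhaseErrorBound κ₀) (hY : E.AdmittanceBound Υ)
    (h35 : W.η < c / (E.ρ * Υ * (c + 5 * κ₀)))
    {γ : ℝ → DvocState N × LineState M} (hsol : E.IsSolutionOn W γ (Ici 0)) :
    DissipativeCurve (E.fullField W) (E.nu W C (E.dWeight κ₀ Υ) (W.alpha1 c κ₀))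
      (E.rate W C (E.mLB W c κ₀ Υ) (E.dWeight κ₀ Υ) κ₀)
      {x | E.nu W C (E.dWeight κ₀ Υ) (W.alpha1 c κ₀) x
        ≤ E.nu W C (E.dWeight κ₀ Υ) (W.alpha1 c κ₀) (γ 0)} γ where
  hasDeriv t ht := hsol t (mem_Ici.2 ht)
  lyapunov t ht := by
    obtain ⟨D, hD, hle, -⟩ := E.hasDerivWithinAt_nu_le W (C := C) h hC hρ ha hη hα hv hc hκ₀ hcκ
      hΥ h23 hK hY h35 (hsol t (mem_Ici.2 ht))
    refine ⟨D, hD, ?_⟩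
    unfold rate
    linarith
  mapsTo t ht := by
    have hsol' : E.IsSolutionOn W γ (Icc 0 t) := fun τ hτ =>
      (hsol τ (mem_Ici.2 hτ.1)).mono Icc_subset_Ici_self
    exact E.nu_antitoneOn W C h hC hρ ha hη hα hv hc hκ₀ hcκ hΥ h23 hK hY h35 hsol'
      (left_mem_Icc.2 ht) (right_mem_Icc.2 ht) ht

/-- **Theorem 2, attractivity — THE DICHOTOMY** [cite: GrossEtAl2019, Thm. 2]: for `N ≥ 1`
converters and `M` lines (Assumption 1, consistency, `‖Y_l‖ > 0`, `ρ > 0`), gains `η, α > 0`,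
set-points `v_k* > 0`, a margin `c > 0` with the decrease inequality (23), bounds `κ₀ ≥ ‖𝒦 − 𝓛‖`
(`c ≤ κ₀`), `Υ ≥ ‖𝒴‖`, the gain condition (35) `η < c/(ρΥ(c + 5κ₀))`, and a cycle matrix `C` whose
rows span `ker B`: EVERY solution `x(t) = (v(t), i(t))` of the full-order system (15) on `[0, ∞)`
satisfies `dist(x(t), 𝒯) → 0` OR `x(t) → 0ₙ` as `t → ∞`. (Print: «almost globally asymptotically
stable with respect to 𝒯» = this for all `x(0)` outside the region of attraction of `0ₙ`, plus the
measure-zero clause, which is not formalized.) MODELLED: model (15); nothing here is a grid. -/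
theorem tendsto_infDist_target_or_tendsto_zero [NeZero N] (h : E.Consistent W) (hC : E.IsCycle C)
    (hspan : E.SpansCycles C) (hρ : 0 < E.ρ) (ha : ∀ l, 0 < E.a l) (hη : 0 < W.η) (hα : 0 < W.α)
    (hv : ∀ k, 0 < W.vref k) {c κ₀ Υ : ℝ} (hc : 0 < c) (hκ₀ : 0 < κ₀) (hcκ : c ≤ κ₀) (hΥ : 0 < Υ)
    (h23 : W.DecreaseOnS c) (hK : W.PhaseErrorBound κ₀) (hY : E.AdmittanceBound Υ)
    (h35 : W.η < c / (E.ρ * Υ * (c + 5 * κ₀)))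
    {γ : ℝ → DvocState N × LineState M} (hsol : E.IsSolutionOn W γ (Ici 0)) :
    Tendsto (fun t => infDist (γ t) (E.target W)) atTop (𝓝 0) ∨ Tendsto γ atTop (𝓝 0) := by
  have ha' : ∀ l, E.a l ≠ 0 := fun l => (ha l).ne'
  have hinj := E.dev_injective_of_spansCycles C hspan fun l => E.ind_pos hρ (ha l)
  have hΛ : W.Lam ≠ 0 := (W.Lam_pos hv).ne'
  obtain ⟨hd0, hd1⟩ := E.dWeight_mem_Ioo hρ hκ₀ hΥ
  obtain ⟨-, hm⟩ := E.prop7_constants_pos W hρ hη hc hκ₀ hΥ h35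
  have hα₁ : 0 < W.alpha1 c κ₀ := by unfold DvocReduced.alpha1; positivity
  have hw : 0 < W.η * W.α * W.alpha1 c κ₀ := by positivity
  have hcurve := E.dissipativeCurve W C h hC hρ ha' hη hα.le hv hc hκ₀ hcκ hΥ h23 hK hY h35 hsol
  have hK := E.isCompact_nu_sublevel W C hv hρ hinj hd0 hd1 hw
    (E.nu W C (E.dWeight κ₀ Υ) (W.alpha1 c κ₀) (γ 0))
  have hres := hcurve.tendsto_infDist_or_of_disjoint hK (E.continuous_fullField W).continuousOn
    (E.continuous_nu W C _ _).continuousOn (E.continuous_rate W C _ _ _).continuousOn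
    (fun y _ => E.rate_nonneg W C hm.le hd0.le κ₀ y) (U := {(0 : DvocState N × LineState M)})
    (E.isCompact_target W fun k => (hv k).ne')
    isCompact_singleton ?_ (fun y _ => E.nu_nonneg W C hΛ hρ.le hd0.le hd1.le hw.le y)
    (fun y _ => E.nu_eq_zero_iff W C hΛ hρ hd0 hd1 hw (fun k => (hv k).ne') hinj y) ?_
  · rcases hres.1 with hT | h0
    · exact Or.inl hT
    · right
      rw [tendsto_iff_dist_tendsto_zero]
      simpa [infDist_singleton] using h0
  · -- `𝒯` misses the origin: `ν(0) > 0`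
    rw [Set.disjoint_singleton_right]
    intro h0
    have hz := (E.nu_eq_zero_iff W C hΛ hρ hd0 hd1 hw (fun k => (hv k).ne') hinj 0).2 h0
    rw [E.nu_zero W C] at hz
    have : 0 < (1 - E.dWeight κ₀ Υ) * (1 / 2 * W.η * W.α * W.alpha1 c κ₀ * W.Lam) := by
      have := W.Lam_pos hv; have : 0 < 1 - E.dWeight κ₀ Υ := by linarith
      positivity
    linarith
  · -- zero set of the rate
    intro y hy
    rcases (E.rate_eq_zero_iff W C hη hα hκ₀ hv hρ hinj hm hd0 y).1 hy.2 with hT | h0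
    · exact Or.inl hT
    · exact Or.inr h0

/-- **Theorem 2, the explicit region of attraction**
[cite: GrossEtAl2019, Thm. 2 (proof, via Thm. 1 with 𝒰 = {0ₙ})]: under the hypotheses of
`tendsto_infDist_target_or_tendsto_zero`, every
solution of (15) on `[0, ∞)` whose initial state satisfies
`ν(x(0)) < ν(0ₙ) = (1 − d)·½ηαα₁Σ_k v_k*²` has `dist(x(t), 𝒯) → 0` — the sublevel set
`{ν < ν(0ₙ)}` is a CERTIFIED subset of the region of attraction of `𝒯` (the origin, the print's
measure-zero exception, sits exactly at the excluded level). MODELLED: model (15). -/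
theorem tendsto_infDist_target_of_nu_lt [NeZero N] (h : E.Consistent W) (hC : E.IsCycle C)
    (hspan : E.SpansCycles C) (hρ : 0 < E.ρ) (ha : ∀ l, 0 < E.a l) (hη : 0 < W.η) (hα : 0 < W.α)
    (hv : ∀ k, 0 < W.vref k) {c κ₀ Υ : ℝ} (hc : 0 < c) (hκ₀ : 0 < κ₀) (hcκ : c ≤ κ₀) (hΥ : 0 < Υ)
    (h23 : W.DecreaseOnS c) (hK : W.PhaseErrorBound κ₀) (hY : E.AdmittanceBound Υ)
    (h35 : W.η < c / (E.ρ * Υ * (c + 5 * κ₀)))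
    {γ : ℝ → DvocState N × LineState M} (hsol : E.IsSolutionOn W γ (Ici 0))
    (hlt : E.nu W C (E.dWeight κ₀ Υ) (W.alpha1 c κ₀) (γ 0)
      < E.nu W C (E.dWeight κ₀ Υ) (W.alpha1 c κ₀) 0) :
    Tendsto (fun t => infDist (γ t) (E.target W)) atTop (𝓝 0) := by
  have ha' : ∀ l, E.a l ≠ 0 := fun l => (ha l).ne'
  have hinj := E.dev_injective_of_spansCycles C hspan fun l => E.ind_pos hρ (ha l)
  have hΛ : W.Lam ≠ 0 := (W.Lam_pos hv).ne'
  obtain ⟨hd0, hd1⟩ := E.dWeight_mem_Ioo hρ hκ₀ hΥ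
  obtain ⟨-, hm⟩ := E.prop7_constants_pos W hρ hη hc hκ₀ hΥ h35
  have hα₁ : 0 < W.alpha1 c κ₀ := by unfold DvocReduced.alpha1; positivity
  have hw : 0 < W.η * W.α * W.alpha1 c κ₀ := by positivity
  have hcurve := E.dissipativeCurve W C h hC hρ ha' hη hα.le hv hc hκ₀ hcκ hΥ h23 hK hY h35 hsol
  have hK := E.isCompact_nu_sublevel W C hv hρ hinj hd0 hd1 hw
    (E.nu W C (E.dWeight κ₀ Υ) (W.alpha1 c κ₀) (γ 0))
  refine hcurve.tendsto_infDist_of_apply_lt hK (E.continuous_fullField W).continuousOn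
    (E.continuous_nu W C _ _).continuousOn (E.continuous_rate W C _ _ _).continuousOn
    (fun y _ => E.rate_nonneg W C hm.le hd0.le κ₀ y) (B := {0}) isClosed_singleton ?_
    (b := E.nu W C (E.dWeight κ₀ Υ) (W.alpha1 c κ₀) 0) ?_ le_rfl hlt
  · intro y hy
    rcases (E.rate_eq_zero_iff W C hη hα hκ₀ hv hρ hinj hm hd0 y).1 hy.2 with hT | h0
    · exact Or.inl hT
    · exact Or.inr h0
  · rintro y ⟨hy, -⟩
    rw [Set.mem_singleton_iff.1 hy]

/-- **Theorem 2, stability: `𝒯` is Lyapunov stable for (15)**, uniformly over solutions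
[cite: GrossEtAl2019, Thm. 2 (proof: «χ₁(‖x‖_𝒯) ≤ ν(x) ≤ χ₂(‖x‖_𝒯)» and Thm. 1)]: for every `ε > 0`
there is `δ > 0` such that every solution of (15) on `[0, ∞)` starting within `δ` of `𝒯` stays within
`ε` of `𝒯` (hypotheses as in `tendsto_infDist_target_or_tendsto_zero`). MODELLED: model (15). -/
theorem target_stable [NeZero N] (h : E.Consistent W) (hC : E.IsCycle C)
    (hspan : E.SpansCycles C) (hρ : 0 < E.ρ) (ha : ∀ l, 0 < E.a l) (hη : 0 < W.η) (hα : 0 < W.α)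
    (hv : ∀ k, 0 < W.vref k) {c κ₀ Υ : ℝ} (hc : 0 < c) (hκ₀ : 0 < κ₀) (hcκ : c ≤ κ₀) (hΥ : 0 < Υ)
    (h23 : W.DecreaseOnS c) (hK : W.PhaseErrorBound κ₀) (hY : E.AdmittanceBound Υ)
    (h35 : W.η < c / (E.ρ * Υ * (c + 5 * κ₀))) {ε : ℝ} (hε : 0 < ε) :
    ∃ δ > 0, ∀ γ : ℝ → DvocState N × LineState M, E.IsSolutionOn W γ (Ici 0) →
      infDist (γ 0) (E.target W) < δ → ∀ t, 0 ≤ t → infDist (γ t) (E.target W) < ε := by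
  have ha' : ∀ l, E.a l ≠ 0 := fun l => (ha l).ne'
  have hinj := E.dev_injective_of_spansCycles C hspan fun l => E.ind_pos hρ (ha l)
  have hΛ : W.Lam ≠ 0 := (W.Lam_pos hv).ne'
  obtain ⟨hd0, hd1⟩ := E.dWeight_mem_Ioo hρ hκ₀ hΥ
  obtain ⟨-, hm⟩ := E.prop7_constants_pos W hρ hη hc hκ₀ hΥ h35
  have hα₁ : 0 < W.alpha1 c κ₀ := by unfold DvocReduced.alpha1; positivity
  have hw : 0 < W.η * W.α * W.alpha1 c κ₀ := by positivity
  obtain ⟨δ, hδ, hst⟩ := exists_forall_infDist_lt (E.continuous_nu W C (E.dWeight κ₀ Υ)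
    (W.alpha1 c κ₀)) (fun y => E.nu_nonneg W C hΛ hρ.le hd0.le hd1.le hw.le y)
    (fun y => E.nu_eq_zero_iff W C hΛ hρ hd0 hd1 hw (fun k => (hv k).ne') hinj y)
    (E.isCompact_target W fun k => (hv k).ne') one_pos
    (E.isCompact_nu_sublevel W C hv hρ hinj hd0 hd1 hw 1) hε
  refine ⟨δ, hδ, fun γ hsol h0 t ht => hst γ (fun s hs => ?_) h0 t ht⟩
  exact (E.dissipativeCurve W C h hC hρ ha' hη hα.le hv hc hκ₀ hcκ hΥ h23 hK hY h35 hsol).mapsTo s hs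

/-! ## §6 Along EVERY solution: the rate dies out, line currents lock on, phases synchronise -/

/-- **The dissipation rate of Prop. 7 dies out along every solution of (15)**:
`m(ψ(v(t))² + ‖y_o(t)‖²) + d‖y_n(t)‖² → 0` (hypotheses of the tree's `prop7` plus `α > 0`, `‖Y_l‖ > 0`,
`SpansCycles C`) — Salvadori's theorem applied to `ν`. [cite: GrossEtAl2019, Prop. 7 / Thm. 2 (proof)] -/
theorem tendsto_rate_zero [NeZero N] (h : E.Consistent W) (hC : E.IsCycle C)
    (hspan : E.SpansCycles C) (hρ : 0 < E.ρ) (ha : ∀ l, 0 < E.a l) (hη : 0 < W.η) (hα : 0 < W.α)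
    (hv : ∀ k, 0 < W.vref k) {c κ₀ Υ : ℝ} (hc : 0 < c) (hκ₀ : 0 < κ₀) (hcκ : c ≤ κ₀) (hΥ : 0 < Υ)
    (h23 : W.DecreaseOnS c) (hK : W.PhaseErrorBound κ₀) (hY : E.AdmittanceBound Υ)
    (h35 : W.η < c / (E.ρ * Υ * (c + 5 * κ₀)))
    {γ : ℝ → DvocState N × LineState M} (hsol : E.IsSolutionOn W γ (Ici 0)) :
    Tendsto (fun t => E.rate W C (E.mLB W c κ₀ Υ) (E.dWeight κ₀ Υ) κ₀ (γ t)) atTop (𝓝 0) := by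
  have ha' : ∀ l, E.a l ≠ 0 := fun l => (ha l).ne'
  have hinj := E.dev_injective_of_spansCycles C hspan fun l => E.ind_pos hρ (ha l)
  obtain ⟨hd0, hd1⟩ := E.dWeight_mem_Ioo hρ hκ₀ hΥ
  obtain ⟨-, hm⟩ := E.prop7_constants_pos W hρ hη hc hκ₀ hΥ h35
  have hα₁ : 0 < W.alpha1 c κ₀ := by unfold DvocReduced.alpha1; positivity
  have hw : 0 < W.η * W.α * W.alpha1 c κ₀ := by positivity
  have hcurve := E.dissipativeCurve W C h hC hρ ha' hη hα.le hv hc hκ₀ hcκ hΥ h23 hK hY h35 hsol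
  exact hcurve.tendsto_rate (E.isCompact_nu_sublevel W C hv hρ hinj hd0 hd1 hw _)
    (E.continuous_fullField W).continuousOn (E.continuous_nu W C _ _).continuousOn
    (E.continuous_rate W C _ _ _).continuousOn fun y _ => E.rate_nonneg W C hm.le hd0.le κ₀ y

/-- **Line currents lock onto the quasi-steady-state map along EVERY solution of (15)**:
`i(t) − i^s(v(t)) → 0` — the boundary-layer variable `y` of §IV-C dies out (from `‖y_o‖² + ‖y_n‖² → 0`
and the coercivity `μ‖y‖² ≤ ‖y_o‖² + ‖y_n‖²` of Prop. 4). [cite: GrossEtAl2019, Prop. 4 / Thm. 2 (proof)] -/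
theorem tendsto_dev [NeZero N] (h : E.Consistent W) (hC : E.IsCycle C)
    (hspan : E.SpansCycles C) (hρ : 0 < E.ρ) (ha : ∀ l, 0 < E.a l) (hη : 0 < W.η) (hα : 0 < W.α)
    (hv : ∀ k, 0 < W.vref k) {c κ₀ Υ : ℝ} (hc : 0 < c) (hκ₀ : 0 < κ₀) (hcκ : c ≤ κ₀) (hΥ : 0 < Υ)
    (h23 : W.DecreaseOnS c) (hK : W.PhaseErrorBound κ₀) (hY : E.AdmittanceBound Υ)
    (h35 : W.η < c / (E.ρ * Υ * (c + 5 * κ₀)))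
    {γ : ℝ → DvocState N × LineState M} (hsol : E.IsSolutionOn W γ (Ici 0)) :
    Tendsto (fun t => E.dev (γ t).1 (γ t).2) atTop (𝓝 0) := by
  have hinj := E.dev_injective_of_spansCycles C hspan fun l => E.ind_pos hρ (ha l)
  obtain ⟨hd0, -⟩ := E.dWeight_mem_Ioo hρ hκ₀ hΥ
  obtain ⟨-, hm⟩ := E.prop7_constants_pos W hρ hη hc hκ₀ hΥ h35
  obtain ⟨μ, hμ, hcoer⟩ := E.exists_coercive C hρ hinj
  have hrate := E.tendsto_rate_zero W C h hC hspan hρ ha hη hα hv hc hκ₀ hcκ hΥ h23 hK hY h35 hsol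
  set m := E.mLB W c κ₀ Υ with hmdef
  set d := E.dWeight κ₀ Υ with hddef
  -- `‖y‖² ≤ (1/m + 1/d)/μ · rate`
  set K₀ : ℝ := (1 / m + 1 / d) / μ with hK₀
  have hK₀nn : 0 ≤ K₀ := by positivity
  have hbound : ∀ t, ‖E.dev (γ t).1 (γ t).2‖ ≤ Real.sqrt (K₀ * E.rate W C m d κ₀ (γ t)) := by
    intro t
    refine Real.le_sqrt_of_sq_le ?_
    set y := E.dev (γ t).1 (γ t).2
    have hYo := E.normYoSq_nonneg y
    have hYn := E.normYnSq_nonneg C y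
    have hψ2 := sq_nonneg (W.psi κ₀ (γ t).1)
    have h1 : E.normYoSq y ≤ E.rate W C m d κ₀ (γ t) / m := by
      rw [le_div_iff₀ hm]; unfold rate; nlinarith
    have h2 : E.normYnSq C y ≤ E.rate W C m d κ₀ (γ t) / d := by
      rw [le_div_iff₀ hd0]; unfold rate; nlinarith
    have h3 := hcoer y
    have hr0 := E.rate_nonneg W C hm.le hd0.le κ₀ (γ t)
    calc ‖y‖ ^ 2 ≤ (E.normYoSq y + E.normYnSq C y) / μ := by rw [le_div_iff₀ hμ]; linarith
      _ ≤ (E.rate W C m d κ₀ (γ t) / m + E.rate W C m d κ₀ (γ t) / d) / μ := by gcongr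
      _ = K₀ * E.rate W C m d κ₀ (γ t) := by rw [hK₀]; field_simp
  have hsq : Tendsto (fun t => Real.sqrt (K₀ * E.rate W C m d κ₀ (γ t))) atTop (𝓝 0) := by
    have := (hrate.const_mul K₀).sqrt
    simpa using this
  rw [tendsto_zero_iff_norm_tendsto_zero]
  exact squeeze_zero (fun t => norm_nonneg _) hbound hsq

/-- **Phases synchronise along EVERY solution of (15)**: `‖v(t)‖²_S → 0` (from `ψ(v(t)) → 0` and
`ψ ≥ ηκ₀‖v‖_S`). [cite: GrossEtAl2019, Prop. 7 / Thm. 2 (proof)] -/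
theorem tendsto_normS2 [NeZero N] (h : E.Consistent W) (hC : E.IsCycle C)
    (hspan : E.SpansCycles C) (hρ : 0 < E.ρ) (ha : ∀ l, 0 < E.a l) (hη : 0 < W.η) (hα : 0 < W.α)
    (hv : ∀ k, 0 < W.vref k) {c κ₀ Υ : ℝ} (hc : 0 < c) (hκ₀ : 0 < κ₀) (hcκ : c ≤ κ₀) (hΥ : 0 < Υ)
    (h23 : W.DecreaseOnS c) (hK : W.PhaseErrorBound κ₀) (hY : E.AdmittanceBound Υ)
    (h35 : W.η < c / (E.ρ * Υ * (c + 5 * κ₀)))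
    {γ : ℝ → DvocState N × LineState M} (hsol : E.IsSolutionOn W γ (Ici 0)) :
    Tendsto (fun t => W.normS2 (γ t).1) atTop (𝓝 0) := by
  have hΛ : W.Lam ≠ 0 := (W.Lam_pos hv).ne'
  obtain ⟨hd0, -⟩ := E.dWeight_mem_Ioo hρ hκ₀ hΥ
  obtain ⟨-, hm⟩ := E.prop7_constants_pos W hρ hη hc hκ₀ hΥ h35
  have hrate := E.tendsto_rate_zero W C h hC hspan hρ ha hη hα hv hc hκ₀ hcκ hΥ h23 hK hY h35 hsol
  set m := E.mLB W c κ₀ Υ with hmdef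
  set d := E.dWeight κ₀ Υ with hddef
  set K₀ : ℝ := 1 / (m * (W.η * κ₀) ^ 2) with hK₀
  have hηκ : 0 < W.η * κ₀ := by positivity
  have hbound : ∀ t, W.normS2 (γ t).1 ≤ K₀ * E.rate W C m d κ₀ (γ t) := by
    intro t
    set v := (γ t).1
    have hS0 : 0 ≤ W.normS2 v := W.normS2_nonneg hΛ v
    have hB0 : 0 ≤ ∑ k, W.Phi v k ^ 2 * dvocNsq v k :=
      Finset.sum_nonneg fun k _ => by unfold dvocNsq; positivity
    -- `ψ ≥ η κ₀ √‖v‖²_S`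
    have hψ : W.η * κ₀ * Real.sqrt (W.normS2 v) ≤ W.psi κ₀ v := by
      unfold DvocReduced.psi
      have h3 : 0 ≤ W.η * (W.α * Real.sqrt (∑ k, W.Phi v k ^ 2 * dvocNsq v k)) := by positivity
      have hid : W.η * (κ₀ * Real.sqrt (W.normS2 v)
            + W.α * Real.sqrt (∑ k, W.Phi v k ^ 2 * dvocNsq v k))
          = W.η * κ₀ * Real.sqrt (W.normS2 v)
            + W.η * (W.α * Real.sqrt (∑ k, W.Phi v k ^ 2 * dvocNsq v k)) := by ring
      rw [hid]; linarith
    have hψsq : (W.η * κ₀) ^ 2 * W.normS2 v ≤ W.psi κ₀ v ^ 2 := by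
      have h0 : 0 ≤ W.η * κ₀ * Real.sqrt (W.normS2 v) := by positivity
      have := mul_self_le_mul_self h0 hψ
      rw [← pow_two, ← pow_two, mul_pow, Real.sq_sqrt hS0] at this
      exact this
    have hYo := E.normYoSq_nonneg (E.dev (γ t).1 (γ t).2)
    have hYn := E.normYnSq_nonneg C (E.dev (γ t).1 (γ t).2)
    have hr : W.psi κ₀ v ^ 2 ≤ E.rate W C m d κ₀ (γ t) / m := by
      rw [le_div_iff₀ hm]; unfold rate; nlinarith
    calc W.normS2 v ≤ W.psi κ₀ v ^ 2 / (W.η * κ₀) ^ 2 := by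
          rw [le_div_iff₀ (by positivity)]; linarith
      _ ≤ (E.rate W C m d κ₀ (γ t) / m) / (W.η * κ₀) ^ 2 := by gcongr
      _ = K₀ * E.rate W C m d κ₀ (γ t) := by rw [hK₀]; field_simp
  have hlim : Tendsto (fun t => K₀ * E.rate W C m d κ₀ (γ t)) atTop (𝓝 0) := by
    simpa using hrate.const_mul K₀
  exact squeeze_zero (fun t => W.normS2_nonneg hΛ _) hbound hlim

/-! ## §7 Theorem 2's attractivity under Condition 2 AS PRINTED -/

/-- **Theorem 2 (attractivity, region of attraction) under Condition 2 as printed**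
[cite: GrossEtAl2019, Thm. 2 with Condition 2] (Prop. 2's «‖𝒴‖ ≤ 2 max_k Σ_j ‖Y_jk‖» is NOT used
here — `Υ` stays a certified bound): for `N ≥ 2` converters with symmetric nonnegative edge weights
matching the line set, `‖Y_l‖ > 0`, `ρ > 0`, gains `η, α > 0`, set-points `v_k* > 0`; a margin `c > 0`,
a certified algebraic-connectivity bound `λ ≤ λ₂(L)` (variational form), a steady-state angle bound
`θ̄ ∈ [0, π]`, bounds `v_min ≤ v_k* ≤ v_max`, Condition 2's first inequality (node form), bounds
`‖K_k‖ ≤ κ_K`, `Σ_j‖Y_jk‖ ≤ d`, an admittance bound `Υ`, and (35) with `‖𝒦 − 𝓛‖` replaced by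
`κ_K + 2d`; a cycle matrix `C` whose rows span `ker B`. Then every solution of (15) on `[0, ∞)`
approaches `𝒯` or the origin, and approaches `𝒯` whenever `ν(x(0)) < ν(0ₙ)`. MODELLED: model (15). -/
theorem tendsto_infDist_target_of_condition2 (hN : 2 ≤ N) (h : E.Consistent W) (hC : E.IsCycle C)
    (hspan : E.SpansCycles C) (hsym : ∀ k j, W.w k j = W.w j k) (hw : ∀ k j, 0 ≤ W.w k j)
    (hρ : 0 < E.ρ) (ha : ∀ l, 0 < E.a l) (hη : 0 < W.η) (hα : 0 < W.α) (hv : ∀ k, 0 < W.vref k)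
    {lam c θbar vmin vmax κK d Υ : ℝ} (hc : 0 < c)
    (hlam : ∀ z : Fin N → ℝ,
      lam * pairNormSq z ≤ N * (1 / 2 * ∑ i, ∑ j, W.w i j * (z i - z j) ^ 2))
    (hθ0 : 0 ≤ θbar) (hθπ : θbar ≤ π) (hang : ∀ j k, |W.θ j - W.θ k| ≤ θbar)
    (hvmin : 0 < vmin) (hmin : ∀ k, vmin ≤ W.vref k) (hmax : ∀ k, W.vref k ≤ vmax)
    (hcond : ∀ k,
      W.nodeGainAbs k + W.α < (1 + cos θbar) / 2 * (vmin ^ 2 / vmax ^ 2) * lam - c)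
    (hκK : 0 < κK) (hKk : ∀ k, W.nodeGain k ^ 2 + W.nodeRot k ^ 2 ≤ κK ^ 2)
    (hd : ∀ k, ∑ j, W.w k j ≤ d) (hΥ : 0 < Υ) (hY : E.AdmittanceBound Υ)
    (h35 : W.η < c / (E.ρ * Υ * (c + 5 * (κK + 2 * d))))
    {γ : ℝ → DvocState N × LineState M} (hsol : E.IsSolutionOn W γ (Ici 0)) :
    (Tendsto (fun t => infDist (γ t) (E.target W)) atTop (𝓝 0) ∨ Tendsto γ atTop (𝓝 0)) ∧
    (E.nu W C (E.dWeight (κK + 2 * d) Υ) (W.alpha1 c (κK + 2 * d)) (γ 0)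
        < E.nu W C (E.dWeight (κK + 2 * d) Υ) (W.alpha1 c (κK + 2 * d)) 0 →
      Tendsto (fun t => infDist (γ t) (E.target W)) atTop (𝓝 0)) := by
  haveI : NeZero N := ⟨by omega⟩
  have k0 : Fin N := ⟨0, by omega⟩
  have hd0 : 0 ≤ d := (Finset.sum_nonneg fun j _ => hw k0 j).trans (hd k0)
  have hκ₀ : 0 < κK + 2 * d := by positivity
  have h23 := W.decreaseOnS_of_condition2 hsym hw hv hα.le hc.le hlam hθ0 hθπ hang hvmin hmin hmax
    hcond
  have hK := W.phaseErrorBound_of_bounds hsym hw hv hκK.le hKk hd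
  have hcκ := c_le_kappa0 W hN hv hα.le hκ₀.le h23 hK
  exact ⟨E.tendsto_infDist_target_or_tendsto_zero W C h hC hspan hρ ha hη hα hv hc hκ₀ hcκ hΥ h23
      hK hY h35 hsol,
    fun hlt => E.tendsto_infDist_target_of_nu_lt W C h hC hspan hρ ha hη hα hv hc hκ₀ hcκ hΥ h23 hK
      hY h35 hsol hlt⟩

/-! ## §8 Solutions of (15) exist on `[0, ∞)` from every initial state (append 2026-08-27, same source)

[GrossEtAl2019, proof of Thm. 2 via Thm. 1]: the flow `φ_f(t, x₀)` of (15) is used for all `t ≥ 0` and all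
`x₀ ∈ ℝⁿ`. Here: the field (15) is polynomial (hence `C¹`), `ν` is `C¹` with `Dν(x)·f(x) = ν̇(x) ≤ 0`
(Prop. 7), and every sublevel set of `ν` is compact (`isCompact_nu_sublevel`), so the tree's
continuation theorem `Literature.Analysis.ODE.exists_global_solution_of_sublevel` yields a solution on
`[0, ∞)` from every initial state — the «EVERY solution» statements of §5–§7 are not vacuous. -/

/-- The full-order field (15) is `C¹` (polynomial). [cite: GrossEtAl2019, eq. (15)] -/
theorem contDiff_fullField : ContDiff ℝ 1 (E.fullField W) := by
  unfold fullField fvVec fv₁ fv₂ fiVec fi₁ fi₂ DvocReduced.Kang₁ DvocReduced.Kang₂ DvocReduced.Phi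
    dvocNsq nodeCur₁ nodeCur₂ dV₁ dV₂
  fun_prop

/-- The composite Lyapunov function `ν` (32) is `C¹` (polynomial). [cite: GrossEtAl2019, eq. (32)] -/
theorem contDiff_nu (d α₁ : ℝ) : ContDiff ℝ 1 (E.nu W C d α₁) := by
  unfold nu Wfun normYoSq normYnSq cyc₁ cyc₂ nodeCur nodeCur₁ nodeCur₂ dev iss iss₁ iss₂ dV₁ dV₂
    DvocReduced.V DvocReduced.normS2 DvocReduced.qS DvocReduced.sig₁ DvocReduced.sig₂ dvocDot dvocNsq
  fun_prop

/-- **The Fréchet derivative of `ν` along (15) is the printed `ν̇`** (`Dν(x)·f(x) = nuDot x`): the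
tree's chain rule `hasDerivWithinAt_nu` along the straight line `x + τ f(x)`, uniqueness of
derivatives. [cite: GrossEtAl2019, proof of Prop. 7] -/
theorem fderiv_nu_fullField (h : E.Consistent W) (hρ : E.ρ ≠ 0) (ha : ∀ l, E.a l ≠ 0)
    (hC : E.IsCycle C) (d α₁ : ℝ) (x : DvocState N × LineState M) :
    fderiv ℝ (E.nu W C d α₁) x (E.fullField W x) = E.nuDot W C d α₁ x := by
  set γ : ℝ → DvocState N × LineState M := fun τ => x + τ • E.fullField W x with hγdef
  have hγ0 : γ 0 = x := by simp [hγdef]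
  have hγ : HasDerivAt γ (E.fullField W x) 0 := by
    have h := ((hasDerivAt_id (0 : ℝ)).smul_const (E.fullField W x)).const_add x
    simpa [hγdef] using h
  have hνx : HasFDerivAt (E.nu W C d α₁) (fderiv ℝ (E.nu W C d α₁) x) (γ 0) := by
    rw [hγ0]; exact ((E.contDiff_nu W C d α₁).differentiable one_ne_zero x).hasFDerivAt
  have h1 : HasDerivAt (fun τ => E.nu W C d α₁ (γ τ)) (fderiv ℝ (E.nu W C d α₁) x (E.fullField W x)) 0 :=
    hνx.comp_hasDerivAt 0 hγ
  have h2 : HasDerivAt (fun τ => E.nu W C d α₁ (γ τ)) (E.nuDot W C d α₁ (γ 0)) 0 := by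
    have h' := E.hasDerivWithinAt_nu W C h hρ ha hC d α₁ (γ := γ) (s := univ) (t := 0)
      (by rw [hγ0]; exact hγ.hasDerivWithinAt)
    exact hasDerivWithinAt_univ.1 h'
  rw [hγ0] at h2
  exact h1.unique h2

/-- **From every initial state a solution of (15) on `[0, ∞)` exists** (hypotheses of the tree's
`prop7` plus `α > 0`, `‖Y_l‖ > 0`, `SpansCycles C`): `f ∈ C¹`, `Dν·f ≤ 0` everywhere (Prop. 7), compact
sublevel sets of `ν`; continuation by the tree's `exists_global_solution_of_sublevel`, then the
within-`Icc 0 T` solution is a solution within `Ici 0`. [cite: GrossEtAl2019, Thm. 2 (proof)] -/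
theorem exists_isSolutionOn [NeZero N] (h : E.Consistent W) (hC : E.IsCycle C)
    (hspan : E.SpansCycles C) (hρ : 0 < E.ρ) (ha : ∀ l, 0 < E.a l) (hη : 0 < W.η) (hα : 0 < W.α)
    (hv : ∀ k, 0 < W.vref k) {c κ₀ Υ : ℝ} (hc : 0 < c) (hκ₀ : 0 < κ₀) (hcκ : c ≤ κ₀) (hΥ : 0 < Υ)
    (h23 : W.DecreaseOnS c) (hK : W.PhaseErrorBound κ₀) (hY : E.AdmittanceBound Υ)
    (h35 : W.η < c / (E.ρ * Υ * (c + 5 * κ₀))) (x₀ : DvocState N × LineState M) :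
    ∃ γ : ℝ → DvocState N × LineState M, γ 0 = x₀ ∧ E.IsSolutionOn W γ (Ici 0) := by
  have ha' : ∀ l, E.a l ≠ 0 := fun l => (ha l).ne'
  have hinj := E.dev_injective_of_spansCycles C hspan fun l => E.ind_pos hρ (ha l)
  obtain ⟨hd0, hd1⟩ := E.dWeight_mem_Ioo hρ hκ₀ hΥ
  obtain ⟨-, hm⟩ := E.prop7_constants_pos W hρ hη hc hκ₀ hΥ h35
  have hα₁ : 0 < W.alpha1 c κ₀ := by unfold DvocReduced.alpha1; positivity
  have hw : 0 < W.η * W.α * W.alpha1 c κ₀ := by positivity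
  set ν := E.nu W C (E.dWeight κ₀ Υ) (W.alpha1 c κ₀) with hν
  have hS : IsCompact {x : DvocState N × LineState M | x ∈ (univ : Set _) ∩ univ ∧ ν x ≤ ν x₀} := by
    have := E.isCompact_nu_sublevel W C hv hρ hinj hd0 hd1 hw (ν x₀)
    simpa using this
  obtain ⟨X, hX0, hX⟩ := exists_global_solution_of_sublevel (F := E.fullField W) (V := ν)
    (V' := fun x => fderiv ℝ ν x) (G := univ) (M := univ) (c := ν x₀) isOpen_univ
    (fun x _ => ((E.contDiff_nu W C _ _).differentiable one_ne_zero x).hasFDerivAt)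
    (fun x _ => by
      show fderiv ℝ ν x (E.fullField W x) ≤ 0
      rw [hν, E.fderiv_nu_fullField W C h hρ.ne' ha' hC]
      have h7 := E.prop7 W h (C := C) hρ hη hα.le hv hc hκ₀ hcκ hΥ h23 hK hY h35 x
      have ho := E.normYoSq_nonneg (E.dev x.1 x.2)
      have hn := E.normYnSq_nonneg C (E.dev x.1 x.2)
      nlinarith [sq_nonneg (W.psi κ₀ x.1)])
    hS (E.contDiff_fullField W) (x₀ := x₀) ⟨⟨mem_univ _, mem_univ _⟩, le_rfl⟩
    (fun _ _ _ _ _ _ => mem_univ _)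
  refine ⟨X, hX0, fun t ht => ?_⟩
  have ht0 : 0 ≤ t := ht
  have h1 := hX (t + 1) t ⟨ht0, by linarith⟩
  refine h1.mono_of_mem_nhdsWithin ?_
  have hIio : Iio (t + 1) ∈ 𝓝 t := Iio_mem_nhds (by linarith)
  exact mem_of_superset (inter_mem_nhdsWithin (Ici (0 : ℝ)) hIio) fun s hs => ⟨hs.1, hs.2.le⟩

/-! ## §9 The origin: an equilibrium of (15) reached by the rest solution (append 2026-08-27, same source)

The second alternative of the dichotomy is realised: `x ≡ 0ₙ` solves (15) («𝒯₀ := 𝒯 ∪ {0ₙ}», p0005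
L16; «the origin 0ₙ is an … unstable equilibrium», p0005 L77), it keeps `ν ≡ ν(0ₙ) > 0` and stays at
the positive distance `dist(0ₙ, 𝒯)` from the target set — so no kernel statement about (15) can
replace «OR x(t) → 0ₙ» by nothing; the print removes it by the (untyped) measure-zero clause. -/

/-- **`0ₙ` is an equilibrium of (15)**: `f(0ₙ) = 0`. [cite: GrossEtAl2019, §IV-A («𝒯₀ := 𝒯 ∪ {0ₙ}»),
Thm. 2] -/
theorem fullField_zero : E.fullField W (0 : DvocState N × LineState M) = 0 := by
  refine Prod.ext (Prod.ext (funext fun k => ?_) (funext fun k => ?_))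
    (Prod.ext (funext fun l => ?_) (funext fun l => ?_)) <;>
    simp [fullField, fvVec, fv₁, fv₂, fiVec, fi₁, fi₂, DvocReduced.Kang₁, DvocReduced.Kang₂,
      nodeCur₁, nodeCur₂, dV₁, dV₂]

/-- **The rest solution `x ≡ 0ₙ` solves (15)** on every time set — the second alternative of
`tendsto_infDist_target_or_tendsto_zero` is realised. [cite: GrossEtAl2019, Thm. 2 («the origin 0ₙ is an
… equilibrium»)] -/
theorem isSolutionOn_zero (s : Set ℝ) :
    E.IsSolutionOn W (fun _ : ℝ => (0 : DvocState N × LineState M)) s := by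
  intro t _
  rw [E.fullField_zero W]
  exact hasDerivWithinAt_const t s (0 : DvocState N × LineState M)

/-- **The origin stays at a positive distance from `𝒯`**: `0 < dist(0ₙ, 𝒯)` (`𝒯` is compact, nonempty
for `N ≥ 1`, and misses `0ₙ` since `‖(S(a,b))_k‖ = v_k* > 0` on it). [cite: GrossEtAl2019, §IV-A (16)] -/
theorem infDist_zero_target_pos [NeZero N] (hv : ∀ k, 0 < W.vref k) :
    0 < infDist (0 : DvocState N × LineState M) (E.target W) := by
  have hv' : ∀ k, W.vref k ≠ 0 := fun k => (hv k).ne'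
  have hne : (E.target W).Nonempty := by
    rw [E.target_eq_image W hv']
    exact ⟨_, ⟨(1, 0), by norm_num, rfl⟩⟩
  have hnot : (0 : DvocState N × LineState M) ∉ E.target W := by
    rintro ⟨-, hA, -⟩
    have h0 := hA (0 : Fin N)
    simp only [dvocNsq, Prod.fst_zero, Prod.snd_zero, Pi.zero_apply] at h0
    have : 0 < W.vref 0 ^ 2 := by have := hv 0; positivity
    nlinarith
  have hcl : IsClosed (E.target W) := (E.isCompact_target W hv').isClosed
  exact (hcl.notMem_iff_infDist_pos hne).1 hnot

/-! ## §10 Uniqueness: a solution of (15) on `[0, ∞)` is determined by its initial state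
(append 2026-08-27, same source)

With §8 this gives the flow `φ_f(t, x₀)` of the printed proof: from every initial state EXACTLY ONE
solution of (15) on `[0, ∞)` (the field is `C¹`, hence Lipschitz on the compact invariant sublevel set
`{ν ≤ ν(x₀)}` — tree `Literature.Analysis.ODE.exists_lipschitzOnWith_of_isCompact` — and Grönwall's
uniqueness `ODE_solution_unique_of_mem_Icc_right` applies inside it). -/

/-- **Uniqueness of solutions of (15) on `[0, ∞)`** (hypotheses of the tree's `prop7` plus `α > 0`,
`‖Y_l‖ > 0`, `SpansCycles C`): two solutions with the same initial state coincide for all `t ≥ 0`.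
[cite: GrossEtAl2019, Thm. 2 (proof: the flow φ_f(t, x₀) of (15))] -/
theorem isSolutionOn_unique [NeZero N] (h : E.Consistent W) (hC : E.IsCycle C)
    (hspan : E.SpansCycles C) (hρ : 0 < E.ρ) (ha : ∀ l, 0 < E.a l) (hη : 0 < W.η) (hα : 0 < W.α)
    (hv : ∀ k, 0 < W.vref k) {c κ₀ Υ : ℝ} (hc : 0 < c) (hκ₀ : 0 < κ₀) (hcκ : c ≤ κ₀) (hΥ : 0 < Υ)
    (h23 : W.DecreaseOnS c) (hK : W.PhaseErrorBound κ₀) (hY : E.AdmittanceBound Υ)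
    (h35 : W.η < c / (E.ρ * Υ * (c + 5 * κ₀)))
    {γ₁ γ₂ : ℝ → DvocState N × LineState M} (h₁ : E.IsSolutionOn W γ₁ (Ici 0))
    (h₂ : E.IsSolutionOn W γ₂ (Ici 0)) (h0 : γ₁ 0 = γ₂ 0) {t : ℝ} (ht : 0 ≤ t) : γ₁ t = γ₂ t := by
  have ha' : ∀ l, E.a l ≠ 0 := fun l => (ha l).ne'
  have hinj := E.dev_injective_of_spansCycles C hspan fun l => E.ind_pos hρ (ha l)
  obtain ⟨hd0, hd1⟩ := E.dWeight_mem_Ioo hρ hκ₀ hΥ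
  have hα₁ : 0 < W.alpha1 c κ₀ := by unfold DvocReduced.alpha1; positivity
  have hw : 0 < W.η * W.α * W.alpha1 c κ₀ := by positivity
  have hc₁ := E.dissipativeCurve W C h hC hρ ha' hη hα.le hv hc hκ₀ hcκ hΥ h23 hK hY h35 h₁
  have hc₂ := E.dissipativeCurve W C h hC hρ ha' hη hα.le hv hc hκ₀ hcκ hΥ h23 hK hY h35 h₂
  set K : Set (DvocState N × LineState M) :=
    {x | E.nu W C (E.dWeight κ₀ Υ) (W.alpha1 c κ₀) x
      ≤ E.nu W C (E.dWeight κ₀ Υ) (W.alpha1 c κ₀) (γ₁ 0)} with hKdef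
  have hKc : IsCompact K := E.isCompact_nu_sublevel W C hv hρ hinj hd0 hd1 hw _
  obtain ⟨L, hL⟩ := exists_lipschitzOnWith_of_isCompact isOpen_univ
    (E.contDiff_fullField W).contDiffOn hKc (subset_univ _)
  have heq := ODE_solution_unique_of_mem_Icc_right (v := fun _ => E.fullField W) (s := fun _ => K)
    (K := L) (f := γ₁) (g := γ₂) (a := 0) (b := t) (fun _ _ => hL)
    (fun τ hτ => ((h₁ τ hτ.1).continuousWithinAt).mono Icc_subset_Ici_self)
    (fun τ hτ => (h₁ τ hτ.1).mono (Ici_subset_Ici.2 hτ.1))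
    (fun τ hτ => hc₁.mapsTo τ hτ.1)
    (fun τ hτ => ((h₂ τ hτ.1).continuousWithinAt).mono Icc_subset_Ici_self)
    (fun τ hτ => (h₂ τ hτ.1).mono (Ici_subset_Ici.2 hτ.1))
    (fun τ hτ => by
      have := hc₂.mapsTo τ hτ.1
      show E.nu W C (E.dWeight κ₀ Υ) (W.alpha1 c κ₀) (γ₂ τ)
        ≤ E.nu W C (E.dWeight κ₀ Υ) (W.alpha1 c κ₀) (γ₁ 0)
      rw [h0]; exact this)
    h0
  exact heq ⟨ht, le_rfl⟩

/-- **Well-posedness of (15) on `[0, ∞)`**: from every initial state there is EXACTLY ONE solution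
(existence §8, uniqueness above; uniqueness in the sense that any two solutions on `[0, ∞)` agree
there). [cite: GrossEtAl2019, Thm. 2 (proof: the flow φ_f(t, x₀) of (15))] -/
theorem existsUnique_isSolutionOn [NeZero N] (h : E.Consistent W) (hC : E.IsCycle C)
    (hspan : E.SpansCycles C) (hρ : 0 < E.ρ) (ha : ∀ l, 0 < E.a l) (hη : 0 < W.η) (hα : 0 < W.α)
    (hv : ∀ k, 0 < W.vref k) {c κ₀ Υ : ℝ} (hc : 0 < c) (hκ₀ : 0 < κ₀) (hcκ : c ≤ κ₀) (hΥ : 0 < Υ)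
    (h23 : W.DecreaseOnS c) (hK : W.PhaseErrorBound κ₀) (hY : E.AdmittanceBound Υ)
    (h35 : W.η < c / (E.ρ * Υ * (c + 5 * κ₀))) (x₀ : DvocState N × LineState M) :
    ∃ γ : ℝ → DvocState N × LineState M, (γ 0 = x₀ ∧ E.IsSolutionOn W γ (Ici 0)) ∧
      ∀ γ' : ℝ → DvocState N × LineState M, γ' 0 = x₀ → E.IsSolutionOn W γ' (Ici 0) →
        ∀ t, 0 ≤ t → γ' t = γ t := by
  obtain ⟨γ, hγ0, hγ⟩ := E.exists_isSolutionOn W C h hC hspan hρ ha hη hα hv hc hκ₀ hcκ hΥ h23 hK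
    hY h35 x₀
  refine ⟨γ, ⟨hγ0, hγ⟩, fun γ' hγ'0 hγ' t ht => ?_⟩
  exact E.isSolutionOn_unique W C h hC hspan hρ ha hη hα hv hc hκ₀ hcκ hΥ h23 hK hY h35 hγ' hγ
    (by rw [hγ'0, hγ0]) ht

end convergence

end DvocLines

/-! ## §11 The origin is an UNSTABLE equilibrium of (15) (append 2026-08-27, same source)

[GrossEtAl2019, Thm. 2 «… and the origin 0ₙ is an exponentially unstable equilibrium»; proof p0008
L35–L40: «for all x₀ = (v₀, i^s(v₀)) with v₀ ∈ 𝒮 ∖ {0₂ₙ} it holds that ν₀(0ₙ) > ν₀(x₀) … i.e., the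
origin is an unstable equilibrium»]. Typed here for the NONLINEAR model (15) and the full Lyapunov
function `ν` (32), without linearisation: on the states `x₀ = (S(a,b), i^s(S(a,b)))` (synchronous
voltages of amplitude ratio `√(a² + b²)`, line currents locked on) one has
`ν(x₀) = (1 − d)·½ηαα₁(1 − (a² + b²))²·Λ`, which is `< ν(0ₙ)` as soon as `0 < a² + b² < 2`; by the
region of attraction of §5 every solution issued from such an `x₀` converges to `𝒯`, hence reaches
norm `≥ dist(0ₙ, 𝒯)/2 > 0`, and such `x₀` lie in every ball around `0ₙ`. What is typed is instability
in Lyapunov's sense (for every `δ > 0` an initial state within `δ` of `0ₙ` all of whose solutions leave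
the ball of radius `dist(0ₙ, 𝒯)/2`); the print's «exponentially» (p0008 L38–L40: an eigenvalue of the
linearisation `A₀` with positive real part) and the measure-zero clause remain untyped. -/

namespace DvocReduced

variable {N : ℕ} (W : DvocReduced N)

/-- **The reduced Lyapunov function (19) on the synchronous set**:
`V(S(a,b)) = ½ηαα₁(1 − (a² + b²))²Λ` (`‖S(a,b)‖_S = 0`, `‖S(a,b)_k‖² = v_k*²(a² + b²)`,
`Λ = Σ_k v_k*²`). [cite: GrossEtAl2019, eq. (19), §IV-D] -/
theorem V_embS (hΛ : W.Lam ≠ 0) (α₁ a b : ℝ) :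
    W.V α₁ (W.embS a b) = 1 / 2 * W.η * W.α * α₁ * ((1 - (a ^ 2 + b ^ 2)) ^ 2 * W.Lam) := by
  have hs : ∑ k, (W.vref k ^ 2 - dvocNsq (W.embS a b) k) ^ 2 / W.vref k ^ 2
      = (1 - (a ^ 2 + b ^ 2)) ^ 2 * W.Lam := by
    rw [DvocReduced.Lam, Finset.mul_sum]
    refine Finset.sum_congr rfl fun k _ => ?_
    rw [W.nsq_embS]
    rcases eq_or_ne (W.vref k) 0 with h | h
    · simp [h]
    · field_simp
  rw [DvocReduced.V, W.normS2_embS hΛ, hs]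
  ring

/-- `S(0,0) = 0`. [cite: GrossEtAl2019, §IV-D] -/
theorem embS_zero_zero : W.embS 0 0 = 0 := by
  refine Prod.ext (funext fun k => ?_) (funext fun k => ?_) <;> simp [embS]

end DvocReduced

namespace DvocLines

variable {N M : ℕ} (E : DvocLines N M) (W : DvocReduced N)

section instability

variable {M₀ : ℕ} (C : Fin M₀ → Fin M → ℝ)

/-- `W(0) = 0` for the line-current energy (31). [cite: GrossEtAl2019, eq. (31)] -/
theorem Wfun_zero : E.Wfun C (0 : LineState M) = 0 := by
  simp [Wfun, normYoSq, normYnSq, nodeCur, nodeCur₁, nodeCur₂, cyc₁, cyc₂, dvocNsq]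

/-- With the line currents at their quasi-steady state the composite function (32) reduces to the
voltage part: `ν(v, i^s(v)) = (1 − d)·V(v)`. [cite: GrossEtAl2019, eq. (32)] -/
theorem nu_iss (d α₁ : ℝ) (v : DvocState N) :
    E.nu W C d α₁ (v, E.iss v) = (1 - d) * W.V α₁ v := by
  have hdev : E.dev v (E.iss v) = 0 := sub_self _
  simp only [DvocLines.nu, hdev, E.Wfun_zero C, mul_zero, zero_add]

/-- **`ν(x₀) < ν(0ₙ)` on `x₀ = (S(a,b), i^s(S(a,b)))` with `0 < a² + b² < 2`** (for `d < 1`,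
`ηαα₁ > 0`, `Λ > 0`) — the printed «ν₀(0ₙ) > ν₀(x₀) for all x₀ = (v₀, i^s(v₀)), v₀ ∈ 𝒮 ∖ {0}», here for
`ν` itself. [cite: GrossEtAl2019, Thm. 2 (proof, p0008 L35–L36)] -/
theorem nu_embS_iss_lt_nu_zero (hΛ : 0 < W.Lam) {d α₁ : ℝ} (hd1 : d < 1)
    (hw : 0 < W.η * W.α * α₁) {a b : ℝ} (h0 : 0 < a ^ 2 + b ^ 2) (h2 : a ^ 2 + b ^ 2 < 2) :
    E.nu W C d α₁ (W.embS a b, E.iss (W.embS a b)) < E.nu W C d α₁ 0 := by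
  rw [E.nu_iss W C, W.V_embS hΛ.ne', E.nu_zero W C]
  have hs1 : (1 - (a ^ 2 + b ^ 2)) ^ 2 < 1 := by
    nlinarith [mul_pos h0 (by linarith : (0 : ℝ) < 2 - (a ^ 2 + b ^ 2))]
  have hsq : (1 - (a ^ 2 + b ^ 2)) ^ 2 * W.Lam < W.Lam := by nlinarith
  have h1d : 0 < 1 - d := by linarith
  have hin : 1 / 2 * W.η * W.α * α₁ * ((1 - (a ^ 2 + b ^ 2)) ^ 2 * W.Lam)
      < 1 / 2 * W.η * W.α * α₁ * W.Lam := by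
    have : 0 < 1 / 2 * (W.η * W.α * α₁) := by positivity
    nlinarith
  exact mul_lt_mul_of_pos_left hin h1d

/-- **Initial states arbitrarily close to `0ₙ` below the level `ν(0ₙ)`**: for every `δ > 0` there is
`a ∈ (0, 1)` with `‖(S(a,0), i^s(S(a,0)))‖ < δ` (continuity of `S` and `i^s` at `0`).
[cite: GrossEtAl2019, Thm. 2 (proof, p0008 L35–L36)] -/
theorem exists_embS_iss_norm_lt {δ : ℝ} (hδ : 0 < δ) :
    ∃ a : ℝ, 0 < a ∧ a < 1 ∧ ‖(W.embS a 0, E.iss (W.embS a 0))‖ < δ := by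
  set g : ℝ → DvocState N × LineState M := fun a => (W.embS a 0, E.iss (W.embS a 0)) with hg
  have hcont : Continuous g := by
    have h1 : Continuous fun a : ℝ => W.embS a 0 := by unfold DvocReduced.embS; fun_prop
    exact h1.prodMk (E.continuous_iss.comp h1)
  have hg0 : g 0 = 0 := by
    simp only [hg, W.embS_zero_zero, E.iss_zero, Prod.mk_zero_zero]
  have hev : ∀ᶠ a in 𝓝 (0 : ℝ), ‖g a‖ < δ := by
    have ht : Tendsto g (𝓝 0) (𝓝 0) := by simpa [hg0] using hcont.tendsto 0
    have := (tendsto_iff_norm_sub_tendsto_zero.1 ht)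
    simp only [sub_zero] at this
    exact (tendsto_order.1 this).2 δ hδ
  have hev' : ∀ᶠ a in 𝓝[>] (0 : ℝ), ‖g a‖ < δ ∧ a ∈ Ioo (0 : ℝ) 1 :=
    (hev.filter_mono nhdsWithin_le_nhds).and (Ioo_mem_nhdsGT one_pos)
  obtain ⟨a, ha, ha0, ha1⟩ := hev'.exists
  exact ⟨a, ha0, ha1, ha⟩

/-- **Every solution of (15) issued from `(S(a,b), i^s(S(a,b)))`, `0 < a² + b² < 2`, converges to `𝒯`**
(synchronous voltages of any amplitude ratio in `(0, √2)` with locked line currents lie in the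
region of attraction `{ν < ν(0ₙ)}` of §5). Hypotheses as in `tendsto_infDist_target_or_tendsto_zero`.
[cite: GrossEtAl2019, Thm. 2 (proof)] -/
theorem tendsto_infDist_target_of_embS_iss [NeZero N] (h : E.Consistent W) (hC : E.IsCycle C)
    (hspan : E.SpansCycles C) (hρ : 0 < E.ρ) (ha : ∀ l, 0 < E.a l) (hη : 0 < W.η) (hα : 0 < W.α)
    (hv : ∀ k, 0 < W.vref k) {c κ₀ Υ : ℝ} (hc : 0 < c) (hκ₀ : 0 < κ₀) (hcκ : c ≤ κ₀) (hΥ : 0 < Υ)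
    (h23 : W.DecreaseOnS c) (hK : W.PhaseErrorBound κ₀) (hY : E.AdmittanceBound Υ)
    (h35 : W.η < c / (E.ρ * Υ * (c + 5 * κ₀))) {a b : ℝ} (h0 : 0 < a ^ 2 + b ^ 2)
    (h2 : a ^ 2 + b ^ 2 < 2) {γ : ℝ → DvocState N × LineState M} (hsol : E.IsSolutionOn W γ (Ici 0))
    (hγ0 : γ 0 = (W.embS a b, E.iss (W.embS a b))) :
    Tendsto (fun t => infDist (γ t) (E.target W)) atTop (𝓝 0) := by
  obtain ⟨-, hd1⟩ := E.dWeight_mem_Ioo hρ hκ₀ hΥ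
  have hα₁ : 0 < W.alpha1 c κ₀ := by unfold DvocReduced.alpha1; positivity
  have hw : 0 < W.η * W.α * W.alpha1 c κ₀ := by positivity
  refine E.tendsto_infDist_target_of_nu_lt W C h hC hspan hρ ha hη hα hv hc hκ₀ hcκ hΥ h23 hK hY h35
    hsol ?_
  rw [hγ0]
  exact E.nu_embS_iss_lt_nu_zero W C (W.Lam_pos hv) hd1 hw h0 h2

/-- A solution converging to `𝒯` reaches norm `≥ dist(0ₙ, 𝒯)/2` at some time `t ≥ 0`
(`dist(0ₙ, 𝒯) ≤ dist(x(t), 𝒯) + ‖x(t)‖`). [cite: GrossEtAl2019, Thm. 2 (proof)] -/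
theorem exists_norm_ge_of_tendsto_infDist [NeZero N] (hv : ∀ k, 0 < W.vref k)
    {γ : ℝ → DvocState N × LineState M}
    (hT : Tendsto (fun t => infDist (γ t) (E.target W)) atTop (𝓝 0)) :
    ∃ t, 0 ≤ t ∧ infDist (0 : DvocState N × LineState M) (E.target W) / 2 ≤ ‖γ t‖ := by
  set D := infDist (0 : DvocState N × LineState M) (E.target W) with hD
  have hDpos : 0 < D := E.infDist_zero_target_pos W hv
  have hev : ∀ᶠ t in atTop, infDist (γ t) (E.target W) < D / 2 :=
    (tendsto_order.1 hT).2 _ (by positivity)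
  obtain ⟨t, ht, ht0⟩ := (hev.and (eventually_ge_atTop 0)).exists
  refine ⟨t, ht0, ?_⟩
  have htri : D ≤ infDist (γ t) (E.target W) + dist (0 : DvocState N × LineState M) (γ t) :=
    infDist_le_infDist_add_dist
  rw [dist_comm, dist_zero_right] at htri
  linarith

/-- **Theorem 2 — the origin `0ₙ` is an UNSTABLE equilibrium of (15)** (Lyapunov's sense, every
solution) [cite: GrossEtAl2019, Thm. 2 («the origin 0ₙ is an exponentially unstable equilibrium»;
proof p0008 L35–L40)]: under the hypotheses of `tendsto_infDist_target_or_tendsto_zero` there is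
`ε > 0` (namely `dist(0ₙ, 𝒯)/2`) such that for every `δ > 0` some initial state `x₀` with `‖x₀‖ < δ`
has ALL its solutions on `[0, ∞)` reach norm `≥ ε` (they even converge to `𝒯`,
`tendsto_infDist_target_of_embS_iss`). Typed: Lyapunov instability of the nonlinear model; NOT typed:
«exponentially» (the spectral statement about `A₀`). MODELLED: model (15). -/
theorem origin_unstable' [NeZero N] (h : E.Consistent W) (hC : E.IsCycle C)
    (hspan : E.SpansCycles C) (hρ : 0 < E.ρ) (ha : ∀ l, 0 < E.a l) (hη : 0 < W.η) (hα : 0 < W.α)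
    (hv : ∀ k, 0 < W.vref k) {c κ₀ Υ : ℝ} (hc : 0 < c) (hκ₀ : 0 < κ₀) (hcκ : c ≤ κ₀) (hΥ : 0 < Υ)
    (h23 : W.DecreaseOnS c) (hK : W.PhaseErrorBound κ₀) (hY : E.AdmittanceBound Υ)
    (h35 : W.η < c / (E.ρ * Υ * (c + 5 * κ₀))) :
    ∃ ε > 0, ∀ δ > 0, ∃ x₀ : DvocState N × LineState M, ‖x₀‖ < δ ∧
      ∀ γ : ℝ → DvocState N × LineState M, E.IsSolutionOn W γ (Ici 0) → γ 0 = x₀ →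
        ∃ t, 0 ≤ t ∧ ε ≤ ‖γ t‖ := by
  refine ⟨infDist (0 : DvocState N × LineState M) (E.target W) / 2,
    by have := E.infDist_zero_target_pos W hv; positivity, fun δ hδ => ?_⟩
  obtain ⟨a, ha0, ha1, hlt⟩ := E.exists_embS_iss_norm_lt W hδ
  refine ⟨(W.embS a 0, E.iss (W.embS a 0)), hlt, fun γ hsol hγ0 => ?_⟩
  have h0 : 0 < a ^ 2 + (0 : ℝ) ^ 2 := by positivity
  have h2 : a ^ 2 + (0 : ℝ) ^ 2 < 2 := by nlinarith
  exact E.exists_norm_ge_of_tendsto_infDist W hv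
    (E.tendsto_infDist_target_of_embS_iss W C h hC hspan hρ ha hη hα hv hc hκ₀ hcκ hΥ h23 hK hY h35
      h0 h2 hsol hγ0)

/-- **Theorem 2 — the origin `0ₙ` is an UNSTABLE equilibrium of (15)**, in the shape of the tree's
`DvocReduced.origin_unstable` for (17) [cite: GrossEtAl2019, Thm. 2 («the origin 0ₙ is an
exponentially unstable equilibrium»)]: there is `ε > 0` such that for every `δ > 0` some solution of
(15) on `[0, ∞)` starts in the `δ`-ball around `0ₙ` and reaches norm `≥ ε` (existence of the solution:
§8). Typed: Lyapunov instability; NOT typed: «exponentially». MODELLED: model (15). -/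
theorem origin_unstable [NeZero N] (h : E.Consistent W) (hC : E.IsCycle C)
    (hspan : E.SpansCycles C) (hρ : 0 < E.ρ) (ha : ∀ l, 0 < E.a l) (hη : 0 < W.η) (hα : 0 < W.α)
    (hv : ∀ k, 0 < W.vref k) {c κ₀ Υ : ℝ} (hc : 0 < c) (hκ₀ : 0 < κ₀) (hcκ : c ≤ κ₀) (hΥ : 0 < Υ)
    (h23 : W.DecreaseOnS c) (hK : W.PhaseErrorBound κ₀) (hY : E.AdmittanceBound Υ)
    (h35 : W.η < c / (E.ρ * Υ * (c + 5 * κ₀))) :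
    ∃ ε > 0, ∀ δ > 0, ∃ γ : ℝ → DvocState N × LineState M, E.IsSolutionOn W γ (Ici 0) ∧
      ‖γ 0‖ < δ ∧ ∃ t, 0 ≤ t ∧ ε ≤ ‖γ t‖ := by
  obtain ⟨ε, hε, hall⟩ := E.origin_unstable' W C h hC hspan hρ ha hη hα hv hc hκ₀ hcκ hΥ h23 hK hY h35
  refine ⟨ε, hε, fun δ hδ => ?_⟩
  obtain ⟨x₀, hx₀, hx⟩ := hall δ hδ
  obtain ⟨γ, hγ0, hγ⟩ := E.exists_isSolutionOn W C h hC hspan hρ ha hη hα hv hc hκ₀ hcκ hΥ h23 hK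
    hY h35 x₀
  exact ⟨γ, hγ, by rw [hγ0]; exact hx₀, hx γ hγ hγ0⟩

end instability

/-! ## §12 The cycle matrix is auxiliary: Theorem 2's conclusions from the network and control data
alone (append 2026-08-27, same source)

[GrossEtAl2019, §IV-E p0007 L6–L10]: «the matrix `B_n ∈ ℝ^{M×M₀}` whose columns span the nullspace of
`B`, `𝐁_n := B_n ⊗ I₂`, and `y_n = 𝐁_nᵀ L_T y`. The fact that `G` is connected implies rank(B) = N − 1 and
… M₀ = M − N + 1.» The hypotheses `IsCycle C` / `SpansCycles C` of §§5–11 serve only the construction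
of `ν` (32) through `‖y_n‖²`; a cycle matrix with both properties exists for EVERY network (rows = a
basis of the cycle space `ker B`; any graph, connected or not — connectedness only fixes `M₀`), so every
conclusion that does not mention `ν` holds under the hypotheses on the network and control data alone:
the `thm2_*` theorems below (same statements as §§5–11 with `C` eliminated). -/

section cycleSpace

/-- The oriented incidence map `B : ℝ^M → ℝ^N`, `(B z)_k = Σ_l B_{kl} z_l`, as a linear map.
[cite: GrossEtAl2019, §IV-E p0007 L6–L7 («the nullspace of B»)] -/
def incMap : (Fin M → ℝ) →ₗ[ℝ] (Fin N → ℝ) where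
  toFun z k := ∑ l, E.inc k l * z l
  map_add' z z' := by
    ext k
    simp only [Pi.add_apply, mul_add, Finset.sum_add_distrib]
  map_smul' r z := by
    ext k
    simp only [Pi.smul_apply, smul_eq_mul, RingHom.id_apply, Finset.mul_sum]
    exact Finset.sum_congr rfl fun l _ => by ring

/-- `(B z)_k = Σ_l B_{kl} z_l`. [cite: GrossEtAl2019, §IV-E p0007 L6–L7] -/
@[simp] theorem incMap_apply (z : Fin M → ℝ) (k : Fin N) : E.incMap z k = ∑ l, E.inc k l * z l := rfl

/-- The CYCLE SPACE `ker B ⊆ ℝ^M` of the network graph («the nullspace of B», spanned by the columns of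
`B_n`). [cite: GrossEtAl2019, §IV-E p0007 L6–L7] -/
def cycleSpace : Submodule ℝ (Fin M → ℝ) := LinearMap.ker E.incMap

/-- Membership in the cycle space: `z ∈ ker B ↔ Σ_l B_{kl} z_l = 0` for every node `k`.
[cite: GrossEtAl2019, §IV-E p0007 L6–L7] -/
theorem mem_cycleSpace_iff (z : Fin M → ℝ) :
    z ∈ E.cycleSpace ↔ ∀ k : Fin N, ∑ l, E.inc k l * z l = 0 := by
  rw [cycleSpace, LinearMap.mem_ker]
  exact ⟨fun h k => by simpa using congrFun h k, fun h => funext fun k => by simpa using h k⟩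

/-- **A cycle matrix whose rows form a basis of the cycle space exists for every network** (print:
«the matrix `B_n ∈ ℝ^{M×M₀}` whose columns span the nullspace of `B`», of full rank; here `C = B_nᵀ`
with `M₀ = dim ker B` rows taken from a basis of `ker B`): `IsCycle C ∧ SpansCycles C`. Hence the
auxiliary cycle matrix in the hypotheses of §§5–11 can always be instantiated.
[cite: GrossEtAl2019, §IV-E p0007 L6–L10] -/
theorem exists_isCycle_spansCycles :
    ∃ (M₀ : ℕ) (C : Fin M₀ → Fin M → ℝ), E.IsCycle C ∧ E.SpansCycles C := by
  set K := E.cycleSpace with hK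
  let b := Module.finBasis ℝ K
  refine ⟨Module.finrank ℝ K, fun c l => (b c : Fin M → ℝ) l, ?_, ?_⟩
  · intro c k
    have hmem : ((b c : K) : Fin M → ℝ) ∈ E.cycleSpace := (b c).2
    have := (E.mem_cycleSpace_iff _).1 hmem k
    simpa [mul_comm] using this
  · intro z hz
    have hzK : z ∈ K := (E.mem_cycleSpace_iff z).2 hz
    refine ⟨fun c => b.repr ⟨z, hzK⟩ c, fun l => ?_⟩
    have hsum := b.sum_repr ⟨z, hzK⟩
    have hval := congrArg (fun w : K => (w : Fin M → ℝ) l) hsum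
    simp only [Submodule.coe_sum, Submodule.coe_smul, Finset.sum_apply, Pi.smul_apply,
      smul_eq_mul] at hval
    exact hval.symm

end cycleSpace

section packaged

/-- **Theorem 2 — THE DICHOTOMY, from the data alone** [cite: GrossEtAl2019, Thm. 2]: for `N ≥ 1`
converters and `M` lines (Assumption 1, consistency, `‖Y_l‖ > 0`, `ρ > 0`), gains `η, α > 0`, set-points
`v_k* > 0`, a margin `c > 0` with (23), bounds `κ₀ ≥ ‖𝒦 − 𝓛‖` (`c ≤ κ₀`), `Υ ≥ ‖𝒴‖` and the gain
condition (35): EVERY solution of (15) on `[0, ∞)` satisfies `dist(x(t), 𝒯) → 0` OR `x(t) → 0ₙ`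
(`tendsto_infDist_target_or_tendsto_zero` with the cycle matrix supplied by
`exists_isCycle_spansCycles`). MODELLED: model (15). -/
theorem thm2_dichotomy [NeZero N] (h : E.Consistent W) (hρ : 0 < E.ρ) (ha : ∀ l, 0 < E.a l)
    (hη : 0 < W.η) (hα : 0 < W.α) (hv : ∀ k, 0 < W.vref k) {c κ₀ Υ : ℝ} (hc : 0 < c) (hκ₀ : 0 < κ₀)
    (hcκ : c ≤ κ₀) (hΥ : 0 < Υ) (h23 : W.DecreaseOnS c) (hK : W.PhaseErrorBound κ₀)
    (hY : E.AdmittanceBound Υ) (h35 : W.η < c / (E.ρ * Υ * (c + 5 * κ₀)))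
    {γ : ℝ → DvocState N × LineState M} (hsol : E.IsSolutionOn W γ (Ici 0)) :
    Tendsto (fun t => infDist (γ t) (E.target W)) atTop (𝓝 0) ∨ Tendsto γ atTop (𝓝 0) := by
  obtain ⟨M₀, C, hC, hspan⟩ := E.exists_isCycle_spansCycles
  exact E.tendsto_infDist_target_or_tendsto_zero W C h hC hspan hρ ha hη hα hv hc hκ₀ hcκ hΥ h23 hK hY h35 hsol

/-- **Theorem 2 — `𝒯` is Lyapunov stable for (15), from the data alone** (uniformly over solutions).
[cite: GrossEtAl2019, Thm. 2] MODELLED: model (15). -/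
theorem thm2_target_stable [NeZero N] (h : E.Consistent W) (hρ : 0 < E.ρ) (ha : ∀ l, 0 < E.a l)
    (hη : 0 < W.η) (hα : 0 < W.α) (hv : ∀ k, 0 < W.vref k) {c κ₀ Υ : ℝ} (hc : 0 < c) (hκ₀ : 0 < κ₀)
    (hcκ : c ≤ κ₀) (hΥ : 0 < Υ) (h23 : W.DecreaseOnS c) (hK : W.PhaseErrorBound κ₀)
    (hY : E.AdmittanceBound Υ) (h35 : W.η < c / (E.ρ * Υ * (c + 5 * κ₀))) {ε : ℝ} (hε : 0 < ε) :
    ∃ δ > 0, ∀ γ : ℝ → DvocState N × LineState M, E.IsSolutionOn W γ (Ici 0) →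
      infDist (γ 0) (E.target W) < δ → ∀ t, 0 ≤ t → infDist (γ t) (E.target W) < ε := by
  obtain ⟨M₀, C, hC, hspan⟩ := E.exists_isCycle_spansCycles
  exact E.target_stable W C h hC hspan hρ ha hη hα hv hc hκ₀ hcκ hΥ h23 hK hY h35 hε

/-- **Line currents lock on along EVERY solution of (15), from the data alone**: `i(t) − i^s(v(t)) → 0`.
[cite: GrossEtAl2019, Prop. 4 / Thm. 2 (proof)] MODELLED: model (15). -/
theorem thm2_tendsto_dev [NeZero N] (h : E.Consistent W) (hρ : 0 < E.ρ) (ha : ∀ l, 0 < E.a l)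
    (hη : 0 < W.η) (hα : 0 < W.α) (hv : ∀ k, 0 < W.vref k) {c κ₀ Υ : ℝ} (hc : 0 < c) (hκ₀ : 0 < κ₀)
    (hcκ : c ≤ κ₀) (hΥ : 0 < Υ) (h23 : W.DecreaseOnS c) (hK : W.PhaseErrorBound κ₀)
    (hY : E.AdmittanceBound Υ) (h35 : W.η < c / (E.ρ * Υ * (c + 5 * κ₀)))
    {γ : ℝ → DvocState N × LineState M} (hsol : E.IsSolutionOn W γ (Ici 0)) :
    Tendsto (fun t => E.dev (γ t).1 (γ t).2) atTop (𝓝 0) := by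
  obtain ⟨M₀, C, hC, hspan⟩ := E.exists_isCycle_spansCycles
  exact E.tendsto_dev W C h hC hspan hρ ha hη hα hv hc hκ₀ hcκ hΥ h23 hK hY h35 hsol

/-- **Phases synchronise along EVERY solution of (15), from the data alone**: `‖v(t)‖²_S → 0`.
[cite: GrossEtAl2019, Prop. 7 / Thm. 2 (proof)] MODELLED: model (15). -/
theorem thm2_tendsto_normS2 [NeZero N] (h : E.Consistent W) (hρ : 0 < E.ρ) (ha : ∀ l, 0 < E.a l)
    (hη : 0 < W.η) (hα : 0 < W.α) (hv : ∀ k, 0 < W.vref k) {c κ₀ Υ : ℝ} (hc : 0 < c) (hκ₀ : 0 < κ₀)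
    (hcκ : c ≤ κ₀) (hΥ : 0 < Υ) (h23 : W.DecreaseOnS c) (hK : W.PhaseErrorBound κ₀)
    (hY : E.AdmittanceBound Υ) (h35 : W.η < c / (E.ρ * Υ * (c + 5 * κ₀)))
    {γ : ℝ → DvocState N × LineState M} (hsol : E.IsSolutionOn W γ (Ici 0)) :
    Tendsto (fun t => W.normS2 (γ t).1) atTop (𝓝 0) := by
  obtain ⟨M₀, C, hC, hspan⟩ := E.exists_isCycle_spansCycles
  exact E.tendsto_normS2 W C h hC hspan hρ ha hη hα hv hc hκ₀ hcκ hΥ h23 hK hY h35 hsol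

/-- **Well-posedness of (15) on `[0, ∞)`, from the data alone**: from every initial state EXACTLY ONE
solution (§8 existence, §10 uniqueness). [cite: GrossEtAl2019, Thm. 2 (proof: the flow φ_f(t, x₀))]
MODELLED: model (15). -/
theorem thm2_existsUnique_isSolutionOn [NeZero N] (h : E.Consistent W) (hρ : 0 < E.ρ) (ha : ∀ l, 0 < E.a l)
    (hη : 0 < W.η) (hα : 0 < W.α) (hv : ∀ k, 0 < W.vref k) {c κ₀ Υ : ℝ} (hc : 0 < c) (hκ₀ : 0 < κ₀)
    (hcκ : c ≤ κ₀) (hΥ : 0 < Υ) (h23 : W.DecreaseOnS c) (hK : W.PhaseErrorBound κ₀)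
    (hY : E.AdmittanceBound Υ) (h35 : W.η < c / (E.ρ * Υ * (c + 5 * κ₀))) (x₀ : DvocState N × LineState M) :
    ∃ γ : ℝ → DvocState N × LineState M, (γ 0 = x₀ ∧ E.IsSolutionOn W γ (Ici 0)) ∧
      ∀ γ' : ℝ → DvocState N × LineState M, γ' 0 = x₀ → E.IsSolutionOn W γ' (Ici 0) →
        ∀ t, 0 ≤ t → γ' t = γ t := by
  obtain ⟨M₀, C, hC, hspan⟩ := E.exists_isCycle_spansCycles
  exact E.existsUnique_isSolutionOn W C h hC hspan hρ ha hη hα hv hc hκ₀ hcκ hΥ h23 hK hY h35 x₀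

/-- **Theorem 2 — the origin `0ₙ` is an UNSTABLE equilibrium of (15), from the data alone** (every
solution from the chosen initial states leaves the ball of radius `ε`; Lyapunov's sense — the print's
«exponentially» is not typed). [cite: GrossEtAl2019, Thm. 2] MODELLED: model (15). -/
theorem thm2_origin_unstable' [NeZero N] (h : E.Consistent W) (hρ : 0 < E.ρ) (ha : ∀ l, 0 < E.a l)
    (hη : 0 < W.η) (hα : 0 < W.α) (hv : ∀ k, 0 < W.vref k) {c κ₀ Υ : ℝ} (hc : 0 < c) (hκ₀ : 0 < κ₀)
    (hcκ : c ≤ κ₀) (hΥ : 0 < Υ) (h23 : W.DecreaseOnS c) (hK : W.PhaseErrorBound κ₀)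
    (hY : E.AdmittanceBound Υ) (h35 : W.η < c / (E.ρ * Υ * (c + 5 * κ₀))) :
    ∃ ε > 0, ∀ δ > 0, ∃ x₀ : DvocState N × LineState M, ‖x₀‖ < δ ∧
      ∀ γ : ℝ → DvocState N × LineState M, E.IsSolutionOn W γ (Ici 0) → γ 0 = x₀ →
        ∃ t, 0 ≤ t ∧ ε ≤ ‖γ t‖ := by
  obtain ⟨M₀, C, hC, hspan⟩ := E.exists_isCycle_spansCycles
  exact E.origin_unstable' W C h hC hspan hρ ha hη hα hv hc hκ₀ hcκ hΥ h23 hK hY h35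

/-- **Theorem 2 — the origin `0ₙ` is an UNSTABLE equilibrium of (15), from the data alone**, in the
shape of the tree's `DvocReduced.origin_unstable`. [cite: GrossEtAl2019, Thm. 2] MODELLED: model (15). -/
theorem thm2_origin_unstable [NeZero N] (h : E.Consistent W) (hρ : 0 < E.ρ) (ha : ∀ l, 0 < E.a l)
    (hη : 0 < W.η) (hα : 0 < W.α) (hv : ∀ k, 0 < W.vref k) {c κ₀ Υ : ℝ} (hc : 0 < c) (hκ₀ : 0 < κ₀)
    (hcκ : c ≤ κ₀) (hΥ : 0 < Υ) (h23 : W.DecreaseOnS c) (hK : W.PhaseErrorBound κ₀)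
    (hY : E.AdmittanceBound Υ) (h35 : W.η < c / (E.ρ * Υ * (c + 5 * κ₀))) :
    ∃ ε > 0, ∀ δ > 0, ∃ γ : ℝ → DvocState N × LineState M, E.IsSolutionOn W γ (Ici 0) ∧
      ‖γ 0‖ < δ ∧ ∃ t, 0 ≤ t ∧ ε ≤ ‖γ t‖ := by
  obtain ⟨M₀, C, hC, hspan⟩ := E.exists_isCycle_spansCycles
  exact E.origin_unstable W C h hC hspan hρ ha hη hα hv hc hκ₀ hcκ hΥ h23 hK hY h35

end packaged

/-! ## §13 Theorem 2 under Proposition 2's POWER-FLOW hypotheses, as printed — every `N ≥ 2`, every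
`M`, no cycle matrix, no operator norm (append 2026-08-27, same source)

[GrossEtAl2019, Prop. 2, p0005 L99–L120]: «Condition 2 is satisfied if the steady-state angles θ_jk*,
the set-points p_k*, q_k*, v_k*, and the steady-state branch powers p_jk*, q_jk* satisfy Condition 1,
|θ_jk*| ≤ π/2 holds for all (j,k), and for all k: Σ_j (cos κ/v_k*²)|p_jk*| + (sin κ/v_k*²)|q_jk*| + α
≤ (v*_min²/(2v*_max²)) λ₂(L) − c, η < c/(2ρ d_max(c + 5 max_k s_k* v_k*⁻² + 10 d_max))», and
Theorem 2 holds under Condition 2. The tree's `prop7_of_proposition2` (DVOCLineDynamics §13) already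
turns these printed inequalities into Prop. 7's estimate (`κ₀ = κ_K + 2d`, `Υ = 2d`,
`κ = tan⁻¹(ρω₀)`); composed with §12 this gives Theorem 2's typed conclusions from finitely many
inequalities on the instance data plus one variational `λ ≤ λ₂(L)` certificate — the shape a model
seat discharges by `norm_num` on a concrete network. -/

section proposition2

/-- Proposition 2's printed hypotheses deliver the hypothesis core of §§5–12 with `κ₀ = κ_K + 2d`,
`Υ = 2d`: `c ≤ κ₀`, (23), the phase-error bound, the admittance bound and (35).
[cite: GrossEtAl2019, Prop. 2 with Prop. 7] -/
theorem core_of_proposition2 (hN : 2 ≤ N) (h : E.Consistent W)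
    (hsym : ∀ k j, W.w k j = W.w j k) (hw : ∀ k j, 0 ≤ W.w k j) (hρ : 0 < E.ρ) (hω : 0 ≤ E.ω₀)
    (hα : 0 < W.α) (hv : ∀ k, 0 < W.vref k)
    {lam c vmin vmax κK d : ℝ} (hc : 0 < c)
    (hlam : ∀ z : Fin N → ℝ,
      lam * pairNormSq z ≤ N * (1 / 2 * ∑ i, ∑ j, W.w i j * (z i - z j) ^ 2))
    (hang : ∀ j k, |W.θ j - W.θ k| ≤ π / 2)
    (hvmin : 0 < vmin) (hmin : ∀ k, vmin ≤ W.vref k) (hmax : ∀ k, W.vref k ≤ vmax)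
    (hprop2 : ∀ k, ∑ j, (cos (Real.arctan (E.ρ * E.ω₀)) / W.vref k ^ 2
          * |W.pBranch (Real.arctan (E.ρ * E.ω₀)) k j|
        + sin (Real.arctan (E.ρ * E.ω₀)) / W.vref k ^ 2
          * |W.qBranch (Real.arctan (E.ρ * E.ω₀)) k j|) + W.α
        ≤ vmin ^ 2 / (2 * vmax ^ 2) * lam - c)
    (hκK : 0 < κK) (hKk : ∀ k, W.nodeGain k ^ 2 + W.nodeRot k ^ 2 ≤ κK ^ 2)
    (hdpos : 0 < d) (hd : ∀ k, ∑ j, W.w k j ≤ d)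
    (hη2 : W.η < c / (2 * E.ρ * d * (c + 5 * κK + 10 * d))) :
    c ≤ κK + 2 * d ∧ W.DecreaseOnS c ∧ W.PhaseErrorBound (κK + 2 * d) ∧
      E.AdmittanceBound (2 * d) ∧ W.η < c / (E.ρ * (2 * d) * (c + 5 * (κK + 2 * d))) := by
  haveI : NeZero N := ⟨by omega⟩
  obtain ⟨hκ0, hκ1⟩ := E.arctan_mem (mul_nonneg hρ.le hω)
  have hκ₀ : 0 < κK + 2 * d := by positivity
  have h23 := W.decreaseOnS_of_proposition2 hsym hw hv hα.le hκ0 hκ1 hc hlam hang hvmin hmin hmax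
    hprop2
  have hK := W.phaseErrorBound_of_bounds hsym hw hv hκK.le hKk hd
  have hY := E.admittanceBound_of_degree W h hsym hw hdpos.le hd
  have hcκ := c_le_kappa0 W hN hv hα.le hκ₀.le h23 hK
  have h35 : W.η < c / (E.ρ * (2 * d) * (c + 5 * (κK + 2 * d))) := by
    have : E.ρ * (2 * d) * (c + 5 * (κK + 2 * d)) = 2 * E.ρ * d * (c + 5 * κK + 10 * d) := by ring
    rw [this]; exact hη2
  exact ⟨hcκ, h23, hK, hY, h35⟩

/-- **Theorem 2 — THE DICHOTOMY under Proposition 2 as printed** [cite: GrossEtAl2019, Thm. 2 with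
Prop. 2]: for `N ≥ 2` converters and `M` lines (Assumption 1: `κ = tan⁻¹(ρω₀)`, `ρ > 0`, `ω₀ ≥ 0`;
symmetric nonnegative weights consistent with the line set, `‖Y_l‖ > 0`), gains `η, α > 0`, set-points
`0 < v_min ≤ v_k* ≤ v_max`, steady-state angles `|θ_j − θ_k| ≤ π/2`, a margin `c > 0`, a certified
`λ ≤ λ₂(L)` (variational form), per-node data bounds `‖K_k‖ ≤ κ_K` and `Σ_j ‖Y_jk‖ ≤ d`, and the two
PRINTED inequalities of Prop. 2 (branch-power form; `η < c/(2ρd(c + 5κ_K + 10d))`): EVERY solution of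
the full-order model (15) on `[0, ∞)` satisfies `dist(x(t), 𝒯) → 0` OR `x(t) → 0ₙ`.
MODELLED: model (15); nothing here is a grid. -/
theorem prop2_dichotomy (hN : 2 ≤ N) (h : E.Consistent W)
    (hsym : ∀ k j, W.w k j = W.w j k) (hw : ∀ k j, 0 ≤ W.w k j) (hρ : 0 < E.ρ) (hω : 0 ≤ E.ω₀)
    (ha : ∀ l, 0 < E.a l) (hη : 0 < W.η) (hα : 0 < W.α) (hv : ∀ k, 0 < W.vref k)
    {lam c vmin vmax κK d : ℝ} (hc : 0 < c)
    (hlam : ∀ z : Fin N → ℝ,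
      lam * pairNormSq z ≤ N * (1 / 2 * ∑ i, ∑ j, W.w i j * (z i - z j) ^ 2))
    (hang : ∀ j k, |W.θ j - W.θ k| ≤ π / 2)
    (hvmin : 0 < vmin) (hmin : ∀ k, vmin ≤ W.vref k) (hmax : ∀ k, W.vref k ≤ vmax)
    (hprop2 : ∀ k, ∑ j, (cos (Real.arctan (E.ρ * E.ω₀)) / W.vref k ^ 2
          * |W.pBranch (Real.arctan (E.ρ * E.ω₀)) k j|
        + sin (Real.arctan (E.ρ * E.ω₀)) / W.vref k ^ 2
          * |W.qBranch (Real.arctan (E.ρ * E.ω₀)) k j|) + W.α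
        ≤ vmin ^ 2 / (2 * vmax ^ 2) * lam - c)
    (hκK : 0 < κK) (hKk : ∀ k, W.nodeGain k ^ 2 + W.nodeRot k ^ 2 ≤ κK ^ 2)
    (hdpos : 0 < d) (hd : ∀ k, ∑ j, W.w k j ≤ d)
    (hη2 : W.η < c / (2 * E.ρ * d * (c + 5 * κK + 10 * d)))
    {γ : ℝ → DvocState N × LineState M} (hsol : E.IsSolutionOn W γ (Ici 0)) :
    Tendsto (fun t => infDist (γ t) (E.target W)) atTop (𝓝 0) ∨ Tendsto γ atTop (𝓝 0) := by
  haveI : NeZero N := ⟨by omega⟩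
  obtain ⟨hcκ, h23, hK, hY, h35⟩ := E.core_of_proposition2 W hN h hsym hw hρ hω hα hv hc hlam hang hvmin hmin hmax hprop2 hκK hKk hdpos hd hη2
  exact E.thm2_dichotomy W h hρ ha hη hα hv hc (by positivity) hcκ (by positivity) h23 hK hY h35 hsol

/-- **Theorem 2 — `𝒯` is Lyapunov stable under Proposition 2 as printed** (uniformly over solutions).
[cite: GrossEtAl2019, Thm. 2 with Prop. 2] MODELLED: model (15). -/
theorem prop2_target_stable (hN : 2 ≤ N) (h : E.Consistent W)
    (hsym : ∀ k j, W.w k j = W.w j k) (hw : ∀ k j, 0 ≤ W.w k j) (hρ : 0 < E.ρ) (hω : 0 ≤ E.ω₀)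
    (ha : ∀ l, 0 < E.a l) (hη : 0 < W.η) (hα : 0 < W.α) (hv : ∀ k, 0 < W.vref k)
    {lam c vmin vmax κK d : ℝ} (hc : 0 < c)
    (hlam : ∀ z : Fin N → ℝ,
      lam * pairNormSq z ≤ N * (1 / 2 * ∑ i, ∑ j, W.w i j * (z i - z j) ^ 2))
    (hang : ∀ j k, |W.θ j - W.θ k| ≤ π / 2)
    (hvmin : 0 < vmin) (hmin : ∀ k, vmin ≤ W.vref k) (hmax : ∀ k, W.vref k ≤ vmax)
    (hprop2 : ∀ k, ∑ j, (cos (Real.arctan (E.ρ * E.ω₀)) / W.vref k ^ 2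
          * |W.pBranch (Real.arctan (E.ρ * E.ω₀)) k j|
        + sin (Real.arctan (E.ρ * E.ω₀)) / W.vref k ^ 2
          * |W.qBranch (Real.arctan (E.ρ * E.ω₀)) k j|) + W.α
        ≤ vmin ^ 2 / (2 * vmax ^ 2) * lam - c)
    (hκK : 0 < κK) (hKk : ∀ k, W.nodeGain k ^ 2 + W.nodeRot k ^ 2 ≤ κK ^ 2)
    (hdpos : 0 < d) (hd : ∀ k, ∑ j, W.w k j ≤ d)
    (hη2 : W.η < c / (2 * E.ρ * d * (c + 5 * κK + 10 * d))) {ε : ℝ} (hε : 0 < ε) :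
    ∃ δ > 0, ∀ γ : ℝ → DvocState N × LineState M, E.IsSolutionOn W γ (Ici 0) →
      infDist (γ 0) (E.target W) < δ → ∀ t, 0 ≤ t → infDist (γ t) (E.target W) < ε := by
  haveI : NeZero N := ⟨by omega⟩
  obtain ⟨hcκ, h23, hK, hY, h35⟩ := E.core_of_proposition2 W hN h hsym hw hρ hω hα hv hc hlam hang hvmin hmin hmax hprop2 hκK hKk hdpos hd hη2
  exact E.thm2_target_stable W h hρ ha hη hα hv hc (by positivity) hcκ (by positivity) h23 hK hY h35
    hε

/-- **Along EVERY solution of (15), under Proposition 2 as printed: line currents lock on and phases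
synchronise** — `i(t) − i^s(v(t)) → 0` and `‖v(t)‖²_S → 0`. [cite: GrossEtAl2019, Thm. 2 with
Prop. 2 (proof: Prop. 4, Prop. 7)] MODELLED: model (15). -/
theorem prop2_tendsto_dev_and_normS2 (hN : 2 ≤ N) (h : E.Consistent W)
    (hsym : ∀ k j, W.w k j = W.w j k) (hw : ∀ k j, 0 ≤ W.w k j) (hρ : 0 < E.ρ) (hω : 0 ≤ E.ω₀)
    (ha : ∀ l, 0 < E.a l) (hη : 0 < W.η) (hα : 0 < W.α) (hv : ∀ k, 0 < W.vref k)
    {lam c vmin vmax κK d : ℝ} (hc : 0 < c)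
    (hlam : ∀ z : Fin N → ℝ,
      lam * pairNormSq z ≤ N * (1 / 2 * ∑ i, ∑ j, W.w i j * (z i - z j) ^ 2))
    (hang : ∀ j k, |W.θ j - W.θ k| ≤ π / 2)
    (hvmin : 0 < vmin) (hmin : ∀ k, vmin ≤ W.vref k) (hmax : ∀ k, W.vref k ≤ vmax)
    (hprop2 : ∀ k, ∑ j, (cos (Real.arctan (E.ρ * E.ω₀)) / W.vref k ^ 2
          * |W.pBranch (Real.arctan (E.ρ * E.ω₀)) k j|
        + sin (Real.arctan (E.ρ * E.ω₀)) / W.vref k ^ 2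
          * |W.qBranch (Real.arctan (E.ρ * E.ω₀)) k j|) + W.α
        ≤ vmin ^ 2 / (2 * vmax ^ 2) * lam - c)
    (hκK : 0 < κK) (hKk : ∀ k, W.nodeGain k ^ 2 + W.nodeRot k ^ 2 ≤ κK ^ 2)
    (hdpos : 0 < d) (hd : ∀ k, ∑ j, W.w k j ≤ d)
    (hη2 : W.η < c / (2 * E.ρ * d * (c + 5 * κK + 10 * d)))
    {γ : ℝ → DvocState N × LineState M} (hsol : E.IsSolutionOn W γ (Ici 0)) :
    Tendsto (fun t => E.dev (γ t).1 (γ t).2) atTop (𝓝 0) ∧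
      Tendsto (fun t => W.normS2 (γ t).1) atTop (𝓝 0) := by
  haveI : NeZero N := ⟨by omega⟩
  obtain ⟨hcκ, h23, hK, hY, h35⟩ := E.core_of_proposition2 W hN h hsym hw hρ hω hα hv hc hlam hang hvmin hmin hmax hprop2 hκK hKk hdpos hd hη2
  exact ⟨E.thm2_tendsto_dev W h hρ ha hη hα hv hc (by positivity) hcκ (by positivity) h23 hK hY h35
      hsol,
    E.thm2_tendsto_normS2 W h hρ ha hη hα hv hc (by positivity) hcκ (by positivity) h23 hK hY h35
      hsol⟩

/-- **Well-posedness of (15) on `[0, ∞)` under Proposition 2 as printed**: from every initial state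
EXACTLY ONE solution. [cite: GrossEtAl2019, Thm. 2 with Prop. 2 (proof: the flow φ_f(t, x₀))]
MODELLED: model (15). -/
theorem prop2_existsUnique_isSolutionOn (hN : 2 ≤ N) (h : E.Consistent W)
    (hsym : ∀ k j, W.w k j = W.w j k) (hw : ∀ k j, 0 ≤ W.w k j) (hρ : 0 < E.ρ) (hω : 0 ≤ E.ω₀)
    (ha : ∀ l, 0 < E.a l) (hη : 0 < W.η) (hα : 0 < W.α) (hv : ∀ k, 0 < W.vref k)
    {lam c vmin vmax κK d : ℝ} (hc : 0 < c)
    (hlam : ∀ z : Fin N → ℝ,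
      lam * pairNormSq z ≤ N * (1 / 2 * ∑ i, ∑ j, W.w i j * (z i - z j) ^ 2))
    (hang : ∀ j k, |W.θ j - W.θ k| ≤ π / 2)
    (hvmin : 0 < vmin) (hmin : ∀ k, vmin ≤ W.vref k) (hmax : ∀ k, W.vref k ≤ vmax)
    (hprop2 : ∀ k, ∑ j, (cos (Real.arctan (E.ρ * E.ω₀)) / W.vref k ^ 2
          * |W.pBranch (Real.arctan (E.ρ * E.ω₀)) k j|
        + sin (Real.arctan (E.ρ * E.ω₀)) / W.vref k ^ 2
          * |W.qBranch (Real.arctan (E.ρ * E.ω₀)) k j|) + W.α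
        ≤ vmin ^ 2 / (2 * vmax ^ 2) * lam - c)
    (hκK : 0 < κK) (hKk : ∀ k, W.nodeGain k ^ 2 + W.nodeRot k ^ 2 ≤ κK ^ 2)
    (hdpos : 0 < d) (hd : ∀ k, ∑ j, W.w k j ≤ d)
    (hη2 : W.η < c / (2 * E.ρ * d * (c + 5 * κK + 10 * d))) (x₀ : DvocState N × LineState M) :
    ∃ γ : ℝ → DvocState N × LineState M, (γ 0 = x₀ ∧ E.IsSolutionOn W γ (Ici 0)) ∧
      ∀ γ' : ℝ → DvocState N × LineState M, γ' 0 = x₀ → E.IsSolutionOn W γ' (Ici 0) →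
        ∀ t, 0 ≤ t → γ' t = γ t := by
  haveI : NeZero N := ⟨by omega⟩
  obtain ⟨hcκ, h23, hK, hY, h35⟩ := E.core_of_proposition2 W hN h hsym hw hρ hω hα hv hc hlam hang hvmin hmin hmax hprop2 hκK hKk hdpos hd hη2
  exact E.thm2_existsUnique_isSolutionOn W h hρ ha hη hα hv hc (by positivity) hcκ (by positivity)
    h23 hK hY h35 x₀

/-- **The origin `0ₙ` is an UNSTABLE equilibrium of (15) under Proposition 2 as printed** (Lyapunov's
sense; «exponentially» not typed). [cite: GrossEtAl2019, Thm. 2 with Prop. 2] MODELLED: model (15). -/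
theorem prop2_origin_unstable (hN : 2 ≤ N) (h : E.Consistent W)
    (hsym : ∀ k j, W.w k j = W.w j k) (hw : ∀ k j, 0 ≤ W.w k j) (hρ : 0 < E.ρ) (hω : 0 ≤ E.ω₀)
    (ha : ∀ l, 0 < E.a l) (hη : 0 < W.η) (hα : 0 < W.α) (hv : ∀ k, 0 < W.vref k)
    {lam c vmin vmax κK d : ℝ} (hc : 0 < c)
    (hlam : ∀ z : Fin N → ℝ,
      lam * pairNormSq z ≤ N * (1 / 2 * ∑ i, ∑ j, W.w i j * (z i - z j) ^ 2))
    (hang : ∀ j k, |W.θ j - W.θ k| ≤ π / 2)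
    (hvmin : 0 < vmin) (hmin : ∀ k, vmin ≤ W.vref k) (hmax : ∀ k, W.vref k ≤ vmax)
    (hprop2 : ∀ k, ∑ j, (cos (Real.arctan (E.ρ * E.ω₀)) / W.vref k ^ 2
          * |W.pBranch (Real.arctan (E.ρ * E.ω₀)) k j|
        + sin (Real.arctan (E.ρ * E.ω₀)) / W.vref k ^ 2
          * |W.qBranch (Real.arctan (E.ρ * E.ω₀)) k j|) + W.α
        ≤ vmin ^ 2 / (2 * vmax ^ 2) * lam - c)
    (hκK : 0 < κK) (hKk : ∀ k, W.nodeGain k ^ 2 + W.nodeRot k ^ 2 ≤ κK ^ 2)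
    (hdpos : 0 < d) (hd : ∀ k, ∑ j, W.w k j ≤ d)
    (hη2 : W.η < c / (2 * E.ρ * d * (c + 5 * κK + 10 * d))) :
    ∃ ε > 0, ∀ δ > 0, ∃ γ : ℝ → DvocState N × LineState M, E.IsSolutionOn W γ (Ici 0) ∧
      ‖γ 0‖ < δ ∧ ∃ t, 0 ≤ t ∧ ε ≤ ‖γ t‖ := by
  haveI : NeZero N := ⟨by omega⟩
  obtain ⟨hcκ, h23, hK, hY, h35⟩ := E.core_of_proposition2 W hN h hsym hw hρ hω hα hv hc hlam hang hvmin hmin hmax hprop2 hκK hKk hdpos hd hη2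
  exact E.thm2_origin_unstable W h hρ ha hη hα hv hc (by positivity) hcκ (by positivity) h23 hK hY
    h35

end proposition2

end DvocLines

/-! ## §14 The `λ₂` certificate for a COMPLETE converter graph — the printed three-bus case needs no
eigenvalue computation (append 2026-08-27)

[DorflerBullo2012, arXiv:0910.5673 §5.2, proof of Lemma 5.9]: «the Laplacian of the complete graph with
uniform weights is then given by (n·I_n − 1_n1_nᵀ) = HᵀH … HHᵀ and the complete graph's Laplacian HᵀH
have the same eigenvalues, namely n and 0». Hence when EVERY pair of converters is joined by a line
(complete graph; [GrossEtAl2019, §V-A]: «three inverters and three transmission lines») and all weights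
are `≥ w_min`, the quadratic form dominates termwise: `½ΣΣ w_kj(z_k − z_j)² ≥ w_min‖Hz‖₂²`, i.e. the
variational certificate `λ‖Hz‖₂² ≤ N·½ΣΣ w_kj(z_k − z_j)²` consumed by §§7 and 13 (and by the tree's
`decreaseOnS_of_condition2` / `decreaseOnS_of_proposition2`) holds with `λ = N·w_min` — on such
instances Theorem 2's hypotheses are finitely many closed-form inequalities on the data. -/

namespace DvocReduced

variable {N : ℕ} (W : DvocReduced N)

/-- **`λ₂ ≥ N·w_min` for a complete weighted graph, in the variational form used by the tree**: if
`w_kj ≥ w_min` for all `k ≠ j`, then `(N·w_min)‖Hz‖₂² ≤ N·½Σ_kΣ_j w_kj(z_k − z_j)²` for every `z`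
(`‖Hz‖₂² = pairNormSq z = ½ΣΣ(z_k − z_j)²`). [cite: DorflerBullo2012, arXiv:0910.5673 §5.2 proof of
Lemma 5.9 («the complete graph's Laplacian HᵀH … eigenvalues, namely n and 0»)] -/
theorem lam_of_complete {wmin : ℝ} (hmin : ∀ k j, k ≠ j → wmin ≤ W.w k j) (z : Fin N → ℝ) :
    (N * wmin) * pairNormSq z ≤ N * (1 / 2 * ∑ i, ∑ j, W.w i j * (z i - z j) ^ 2) := by
  have hterm : ∀ i j, wmin * (z i - z j) ^ 2 ≤ W.w i j * (z i - z j) ^ 2 := by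
    intro i j
    rcases eq_or_ne i j with hij | hij
    · simp [hij]
    · exact mul_le_mul_of_nonneg_right (hmin i j hij) (sq_nonneg _)
  have h : wmin * pairNormSq z ≤ 1 / 2 * ∑ i, ∑ j, W.w i j * (z i - z j) ^ 2 := by
    unfold pairNormSq
    have : wmin * (1 / 2 * ∑ i, ∑ j, (z i - z j) ^ 2) = 1 / 2 * ∑ i, ∑ j, wmin * (z i - z j) ^ 2 := by
      rw [Finset.mul_sum]
      simp_rw [Finset.mul_sum]
      ring
    rw [this]
    exact mul_le_mul_of_nonneg_left
      (Finset.sum_le_sum fun i _ => Finset.sum_le_sum fun j _ => hterm i j) (by norm_num)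
  have hN : (0 : ℝ) ≤ N := Nat.cast_nonneg N
  calc (N * wmin) * pairNormSq z = N * (wmin * pairNormSq z) := by ring
    _ ≤ N * (1 / 2 * ∑ i, ∑ j, W.w i j * (z i - z j) ^ 2) := mul_le_mul_of_nonneg_left h hN

end DvocReduced

/-! ## §15 The equilibria of (15) are EXACTLY `𝒯₀ = 𝒯 ∪ {0ₙ}` (append 2026-08-27, same source)

[GrossEtAl2019, §IV-A p0005 L10–L16]: «all elements of 𝒯 are equilibria for the dynamics in the rotating
reference frame (15) … we define the union of 𝒯 and the origin as 𝒯₀ := 𝒯 ∪ {0ₙ}» (tree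
`fullField_eq_zero_of_InT`, `fullField_zero`). The converse — no equilibrium outside `𝒯₀` — is a
corollary of the typed dichotomy (an equilibrium is a constant solution, which can approach `𝒯` or
`0ₙ` only by lying in the closed set `𝒯` or being `0ₙ`); so under the hypotheses of Theorem 2 the
rest points of (15) are exactly the desired synchronous states and the voltage-collapse state. -/

namespace DvocLines

variable {N M : ℕ} (E : DvocLines N M) (W : DvocReduced N)

/-- **The equilibria of the full-order model (15) are exactly `𝒯 ∪ {0ₙ}`** (hypotheses of
`thm2_dichotomy`): `f(x) = 0 ↔ x ∈ 𝒯 ∨ x = 0ₙ`. [cite: GrossEtAl2019, §IV-A (16) («all elements of 𝒯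
are equilibria»), Thm. 2 (corollary: no other equilibria)] MODELLED: model (15). -/
theorem fullField_eq_zero_iff [NeZero N] (h : E.Consistent W) (hρ : 0 < E.ρ) (ha : ∀ l, 0 < E.a l)
    (hη : 0 < W.η) (hα : 0 < W.α) (hv : ∀ k, 0 < W.vref k) {c κ₀ Υ : ℝ} (hc : 0 < c) (hκ₀ : 0 < κ₀)
    (hcκ : c ≤ κ₀) (hΥ : 0 < Υ) (h23 : W.DecreaseOnS c) (hK : W.PhaseErrorBound κ₀)
    (hY : E.AdmittanceBound Υ) (h35 : W.η < c / (E.ρ * Υ * (c + 5 * κ₀))) (x : DvocState N × LineState M) :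
    E.fullField W x = 0 ↔ x ∈ E.target W ∨ x = 0 := by
  have hv' : ∀ k, W.vref k ≠ 0 := fun k => (hv k).ne'
  constructor
  · intro hx
    -- the constant curve at an equilibrium is a solution on `[0, ∞)`
    have hsol : E.IsSolutionOn W (fun _ : ℝ => x) (Ici 0) := fun t _ => by
      rw [hx]; exact hasDerivWithinAt_const t (Ici 0) x
    rcases E.thm2_dichotomy W h hρ ha hη hα hv hc hκ₀ hcκ hΥ h23 hK hY h35 hsol with hT | h0
    · left
      have hd : infDist x (E.target W) = 0 := tendsto_const_nhds_iff.1 hT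
      have hne : (E.target W).Nonempty := by
        rw [E.target_eq_image W hv']
        exact ⟨_, ⟨(1, 0), by norm_num, rfl⟩⟩
      exact ((E.isCompact_target W hv').isClosed.mem_iff_infDist_zero hne).2 hd
    · exact Or.inr (tendsto_const_nhds_iff.1 h0)
  · rintro (hT | h0)
    · exact E.fullField_eq_zero_of_InT W h hρ.ne' (fun l => (ha l).ne') hv' hT
    · rw [h0]; exact E.fullField_zero W

end DvocLines

namespace DvocLines

variable {N M : ℕ} (E : DvocLines N M) (W : DvocReduced N)

/-! ## §16 The control objective «voltage magnitude» (7) along solutions approaching `𝒯`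
(append 2026-08-27, same source)

[GrossEtAl2019, §II-C (7) p0003 L117–L121]: «Voltage magnitude: Given voltage magnitude set-points
v_k* ∈ ℝ_{>0}, at steady state it holds that ‖v_k‖ = v_k*, k ∈ N», and §IV-A p0005 L14–L15: the
elements of `𝒯` «also satisfy all control objectives introduced in Section II-C». Along a solution
with `dist(x(t), 𝒯) → 0` every continuous readout that is constant on the compact set `𝒯` converges
(tree `Literature.Analysis.ODE.tendsto_comp_of_tendsto_infDist`): here the squared amplitudes
`‖v_k(t)‖² → v_k*²`. With §6 (`tendsto_normS2`: phase error → 0; `tendsto_dev`: currents lock on) the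
dichotomy reads in the paper's objectives: EVERY solution of (15) either collapses to `0ₙ` or
regulates every terminal voltage amplitude to its set-point while synchronising in phase. -/

/-- **Voltage regulation along solutions approaching `𝒯`**: `dist(x(t), 𝒯) → 0` implies
`‖v_k(t)‖² → v_k*²` for every converter `k` (`N ≥ 1`, `v_k* ≠ 0`). [cite: GrossEtAl2019, §II-C (7)
with §IV-A (16) («they also satisfy all control objectives»)] MODELLED: model (15). -/
theorem tendsto_nsq_of_tendsto_infDist_target [NeZero N] (hv : ∀ k, W.vref k ≠ 0)
    {γ : ℝ → DvocState N × LineState M}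
    (hT : Tendsto (fun t => infDist (γ t) (E.target W)) atTop (𝓝 0)) (k : Fin N) :
    Tendsto (fun t => dvocNsq (γ t).1 k) atTop (𝓝 (W.vref k ^ 2)) := by
  have hne : (E.target W).Nonempty := by
    rw [E.target_eq_image W hv]
    exact ⟨_, ⟨(1, 0), by norm_num, rfl⟩⟩
  have hcont : Continuous fun x : DvocState N × LineState M => dvocNsq x.1 k := by
    unfold dvocNsq; fun_prop
  exact tendsto_comp_of_tendsto_infDist (E.isCompact_target W hv) hne hcont
    (fun y hy => (show E.InT W y from hy).2.1 k) hT

/-- **Theorem 2 in the words of the control objectives (§II-C)**: under the hypotheses of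
`thm2_dichotomy`, EVERY solution of the full-order model (15) on `[0, ∞)` either tends to `0ₙ`
(voltage collapse — the print's measure-zero exception, untyped) or achieves, asymptotically, voltage
regulation `‖v_k(t)‖² → v_k*²` at every converter, phase synchronisation `‖v(t)‖²_S → 0`, and line
currents at their quasi-steady state `i(t) − i^s(v(t)) → 0`. [cite: GrossEtAl2019, Thm. 2 with §II-C
(7) and §IV-A (16)] MODELLED: model (15); nothing here is a grid. -/
theorem thm2_objectives [NeZero N] (h : E.Consistent W) (hρ : 0 < E.ρ) (ha : ∀ l, 0 < E.a l)
    (hη : 0 < W.η) (hα : 0 < W.α) (hv : ∀ k, 0 < W.vref k) {c κ₀ Υ : ℝ} (hc : 0 < c) (hκ₀ : 0 < κ₀)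
    (hcκ : c ≤ κ₀) (hΥ : 0 < Υ) (h23 : W.DecreaseOnS c) (hK : W.PhaseErrorBound κ₀)
    (hY : E.AdmittanceBound Υ) (h35 : W.η < c / (E.ρ * Υ * (c + 5 * κ₀)))
    {γ : ℝ → DvocState N × LineState M} (hsol : E.IsSolutionOn W γ (Ici 0)) :
    Tendsto γ atTop (𝓝 0) ∨
      ((∀ k, Tendsto (fun t => dvocNsq (γ t).1 k) atTop (𝓝 (W.vref k ^ 2))) ∧
        Tendsto (fun t => W.normS2 (γ t).1) atTop (𝓝 0) ∧
        Tendsto (fun t => E.dev (γ t).1 (γ t).2) atTop (𝓝 0)) := by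
  rcases E.thm2_dichotomy W h hρ ha hη hα hv hc hκ₀ hcκ hΥ h23 hK hY h35 hsol with hT | h0
  · right
    exact ⟨fun k => E.tendsto_nsq_of_tendsto_infDist_target W (fun k => (hv k).ne') hT k,
      E.thm2_tendsto_normS2 W h hρ ha hη hα hv hc hκ₀ hcκ hΥ h23 hK hY h35 hsol,
      E.thm2_tendsto_dev W h hρ ha hη hα hv hc hκ₀ hcκ hΥ h23 hK hY h35 hsol⟩
  · exact Or.inl h0

end DvocLines

/-! ## §17 The control objectives «power injection» (8) and «synchronous frequency» (6) along solutions
approaching `𝒯` (append 2026-08-27, same source)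

[GrossEtAl2019, §II-C p0003 L97–L133]: «Definition 2 (Instantaneous Power) Given the voltage v_k at node
k ∈ N and the output current i_{o,k}, we define the instantaneous active power p_k := v_kᵀ i_{o,k} ∈ ℝ
and the instantaneous reactive power q_k := v_kᵀ J i_{o,k} ∈ ℝ» (`i_o = ℬ i` p0002 L98–L99, `J = R(π/2)`
p0002 L35); «• Synchronous frequency: Given a desired synchronous frequency ω₀ ∈ ℝ_{≥0}, at steady state
it holds that: (d/dt) v_k = ω₀ J v_k, k ∈ N; (6) … • Steady-state currents: it holds that
(d/dt) i = ω₀ J_M i; • Power injection: At steady state, each inverter injects the prescribed active and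
reactive power, i.e., v_kᵀ i_{o,k} = p_k*, v_kᵀ J i_{o,k} = q_k*, k ∈ N. (8)»; §II-D p0004 L1–L12:
«v_k*² e_{p,k} := ‖v_k‖² p_k* − v_k*² p_k and v_k*² e_{q,k} := ‖v_k‖² q_k* − v_k*² q_k. A straightforward
algebraic manipulation reveals that (1/‖v_k‖²)[v_k Jv_k] R(κ) [e_{p,k}; −e_{q,k}] = K_k v_k − R(κ) i_{o,k},
(11)»; Proposition 1 p0004 L60–L69: «It holds that K_k v_k − R(κ) i^s_{o,k} = e_{θ,k}(v)»; §IV-A p0005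
L14–L15: the elements of `𝒯` «also satisfy all control objectives introduced in Section II-C».

Rendering. In the frame rotating at `ω₀` (the tree's (15)), objective (6) and the steady-state-current
objective read `(d/dt) v_k = 0`, `(d/dt) i = 0`, i.e. the right-hand side `f(x)` of (15) vanishes; the
instantaneous powers are the bilinear readouts `p_k(x) = v_kᵀ(ℬ i)_k`, `q_k(x) = v_kᵀ J(ℬ i)_k` of the
state `x = (v, i)`. PROVED below: (11) for every state with `v_k ≠ 0` (`eq11`); Proposition 1 for the
line model, `K_k v_k − R(κ)(𝒴v)_k = e_{θ,k}(v)` with `K_k` in the SET-POINT form and the consistent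
set-points `p_k* = Σ_j p_jk*`, `q_k* = Σ_j q_jk*` of Condition 1 / (36) at `κ = tan⁻¹(ρω₀)` (`prop1`);
ON `𝒯`: `p_k = p_k*`, `q_k = q_k*` (`instP_of_InT`) and `f = 0` (tree `fullField_eq_zero_of_InT`); and,
by the readout lemma `Literature.Analysis.ODE.tendsto_comp_of_tendsto_infDist` on the compact `𝒯`,
ALONG every curve with `dist(x(t), 𝒯) → 0`: `p_k(x(t)) → p_k*`, `q_k(x(t)) → q_k*`
(`tendsto_instP_of_tendsto_infDist_target`), `f(x(t)) → 0` (`tendsto_fullField_of_tendsto_infDist_target`)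
and the rotating-frame angular-velocity deviation `(v_k × v̇_k)/‖v_k‖² → 0`
(`tendsto_freqDev_of_tendsto_infDist_target`); packaged with Theorem 2's dichotomy in
`thm2_powerInjection`. NOT typed: convergence of `x(t)` to a single POINT of `𝒯` (the typed statement is
convergence to the SET `𝒯` with vanishing velocity, which is what (6)–(8) «at steady state» assert of
the elements of `𝒯`). -/

namespace DvocReduced

variable {N : ℕ} (W : DvocReduced N)

/-- **On `𝒮` the dVOC gain acts as the Laplacian**: `K_k v_k = (𝓛 v)_k` for `v ∈ 𝒮` (both
components; all `v_k* ≠ 0`) — Prop. 1 with `e_θ(v) = 0` on `𝒮`. [cite: GrossEtAl2019, Prop. 1 and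
§IV-C («(𝒦 − 𝓛)v = 0 for v ∈ 𝒮»)] -/
theorem Kang_eq_lap_of_InS {v : DvocState N} (hv : W.InS v) (hne : ∀ k, W.vref k ≠ 0) (k : Fin N) :
    W.Kang₁ v k = W.lap₁ v k ∧ W.Kang₂ v k = W.lap₂ v k := by
  have he := W.eθ_of_InS hv hne
  have h1 : W.eθ₁ v k = 0 := by
    have := congrArg (fun u : DvocState N => u.1 k) he
    simpa [DvocReduced.eθ] using this
  have h2 : W.eθ₂ v k = 0 := by
    have := congrArg (fun u : DvocState N => u.2 k) he
    simpa [DvocReduced.eθ] using this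
  rw [W.eθ₁_eq_K_sub_lap] at h1
  rw [W.eθ₂_eq_K_sub_lap] at h2
  exact ⟨by linarith, by linarith⟩

/-- **Power readout of the set-point current**: for `K_k v_k = (1/v_k*²) R(κ)[[p, q],[−q, p]] v_k`
(set-point form) and `i := R(κ)ᵀ K_k v_k = (1/v_k*²)[[p, q],[−q, p]] v_k`, one has
`v_kᵀ i = p‖v_k‖²/v_k*²` and `v_kᵀ J i = q‖v_k‖²/v_k*²` (`v_k = (a, b)`; pure algebra,
`cos²κ + sin²κ = 1`). [cite: GrossEtAl2019, eq. (10)–(11)] -/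
theorem Kpq_readout (κ p q vr a b : ℝ) :
    a * (cos κ * Kpq₁ κ p q vr a b + sin κ * Kpq₂ κ p q vr a b)
        + b * (-sin κ * Kpq₁ κ p q vr a b + cos κ * Kpq₂ κ p q vr a b)
        = p * (a ^ 2 + b ^ 2) / vr ^ 2 ∧
      b * (cos κ * Kpq₁ κ p q vr a b + sin κ * Kpq₂ κ p q vr a b)
        - a * (-sin κ * Kpq₁ κ p q vr a b + cos κ * Kpq₂ κ p q vr a b)
        = q * (a ^ 2 + b ^ 2) / vr ^ 2 := by
  have sc := sin_sq_add_cos_sq κ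
  constructor
  · simp only [Kpq₁, Kpq₂]
    linear_combination (1 / vr ^ 2 * p * (a ^ 2 + b ^ 2)) * sc
  · simp only [Kpq₁, Kpq₂]
    linear_combination (1 / vr ^ 2 * q * (a ^ 2 + b ^ 2)) * sc

end DvocReduced

namespace DvocLines

variable {N M : ℕ} (E : DvocLines N M) (W : DvocReduced N)

/-- **Definition 2, instantaneous ACTIVE power** `p_k := v_kᵀ i_{o,k}` of converter `k` at the state
`x = (v, i)`, output current `i_o = ℬ i`. [cite: GrossEtAl2019, Definition 2] MODELLED: model (15). -/
def instP (x : DvocState N × LineState M) (k : Fin N) : ℝ :=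
  x.1.1 k * E.nodeCur₁ x.2 k + x.1.2 k * E.nodeCur₂ x.2 k

/-- **Definition 2, instantaneous REACTIVE power** `q_k := v_kᵀ J i_{o,k}`, `J = R(π/2)`,
`J(y₁, y₂) = (−y₂, y₁)`. [cite: GrossEtAl2019, Definition 2] MODELLED: model (15). -/
def instQ (x : DvocState N × LineState M) (k : Fin N) : ℝ :=
  x.1.2 k * E.nodeCur₁ x.2 k - x.1.1 k * E.nodeCur₂ x.2 k

/-- Weighted ACTIVE-power error `e_{p,k}`: `v_k*² e_{p,k} := ‖v_k‖² p_k* − v_k*² p_k`, with the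
consistent set-point `p_k* = Σ_j p_jk*` at `κ = tan⁻¹(ρω₀)`. [cite: GrossEtAl2019, §II-D (before (11))] -/
def errP (x : DvocState N × LineState M) (k : Fin N) : ℝ :=
  (dvocNsq x.1 k * W.pSet (Real.arctan (E.ρ * E.ω₀)) k - W.vref k ^ 2 * E.instP x k) / W.vref k ^ 2

/-- Weighted REACTIVE-power error `e_{q,k}`: `v_k*² e_{q,k} := ‖v_k‖² q_k* − v_k*² q_k`.
[cite: GrossEtAl2019, §II-D (before (11))] -/
def errQ (x : DvocState N × LineState M) (k : Fin N) : ℝ :=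
  (dvocNsq x.1 k * W.qSet (Real.arctan (E.ρ * E.ω₀)) k - W.vref k ^ 2 * E.instQ x k) / W.vref k ^ 2

/-- `p_k` is continuous (bilinear in the state). [cite: GrossEtAl2019, Definition 2] -/
theorem continuous_instP (k : Fin N) : Continuous fun x : DvocState N × LineState M => E.instP x k := by
  unfold instP nodeCur₁ nodeCur₂; fun_prop

/-- `q_k` is continuous. [cite: GrossEtAl2019, Definition 2] -/
theorem continuous_instQ (k : Fin N) : Continuous fun x : DvocState N × LineState M => E.instQ x k := by
  unfold instQ nodeCur₁ nodeCur₂; fun_prop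

/-- **Proposition 1 for the line model**: with the CONSISTENT set-points of Condition 1 (branch powers
(36) at `κ = tan⁻¹(ρω₀)`, summed over the lines at each node) the set-point form of the dVOC gain
satisfies `K_k v_k − R(κ) i^s_{o,k}(v) = e_{θ,k}(v)` for EVERY `v`, `i^s_o(v) = 𝒴v = ℬ i^s(v)`; both
components (`Consistent`, `v_k* ≠ 0`). [cite: GrossEtAl2019, Prop. 1] MODELLED: quasi-steady-state
currents. -/
theorem prop1 (h : E.Consistent W) (v : DvocState N) {k : Fin N} (hk : W.vref k ≠ 0) :
    DvocReduced.Kpq₁ (Real.arctan (E.ρ * E.ω₀)) (W.pSet (Real.arctan (E.ρ * E.ω₀)) k)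
          (W.qSet (Real.arctan (E.ρ * E.ω₀)) k) (W.vref k) (v.1 k) (v.2 k)
        - (E.cκ * (E.admit v).1 k - E.sκ * (E.admit v).2 k) = W.eθ₁ v k ∧
      DvocReduced.Kpq₂ (Real.arctan (E.ρ * E.ω₀)) (W.pSet (Real.arctan (E.ρ * E.ω₀)) k)
          (W.qSet (Real.arctan (E.ρ * E.ω₀)) k) (W.vref k) (v.1 k) (v.2 k)
        - (E.sκ * (E.admit v).1 k + E.cκ * (E.admit v).2 k) = W.eθ₂ v k := by
  obtain ⟨hK1, hK2⟩ := W.Kpq_apply_eq_Kang_apply (Real.arctan (E.ρ * E.ω₀)) v hk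
  obtain ⟨hR1, hR2⟩ := E.rot_admit v k
  rw [hK1, hK2, hR1, hR2, ← E.lap₁_eq_lineLap₁ W h, ← E.lap₂_eq_lineLap₂ W h,
    W.eθ₁_eq_K_sub_lap, W.eθ₂_eq_K_sub_lap]
  exact ⟨rfl, rfl⟩

/-- **(11)**: `(1/‖v_k‖²)[v_k Jv_k] R(κ)(e_{p,k}, −e_{q,k}) = K_k v_k − R(κ) i_{o,k}` — the synchronising
dVOC term of (15a) (`K_k` in the angle form `Kang` = the set-point form by Prop. 1, `i_o = ℬ i`) is the
normalised power-tracking error rotated into the frame of `v_k`; both components, at every state with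
`v_k ≠ 0` (`v_k* ≠ 0`; no network hypothesis — (11) is nodal algebra). [cite: GrossEtAl2019, eq. (11)]
MODELLED: model (15). -/
theorem eq11 (x : DvocState N × LineState M) {k : Fin N} (hk : W.vref k ≠ 0)
    (hx : dvocNsq x.1 k ≠ 0) :
    (x.1.1 k * (E.cκ * E.errP W x k + E.sκ * E.errQ W x k)
        - x.1.2 k * (E.sκ * E.errP W x k - E.cκ * E.errQ W x k)) / dvocNsq x.1 k
        = W.Kang₁ x.1 k - (E.cκ * E.nodeCur₁ x.2 k - E.sκ * E.nodeCur₂ x.2 k) ∧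
      (x.1.2 k * (E.cκ * E.errP W x k + E.sκ * E.errQ W x k)
        + x.1.1 k * (E.sκ * E.errP W x k - E.cκ * E.errQ W x k)) / dvocNsq x.1 k
        = W.Kang₂ x.1 k - (E.sκ * E.nodeCur₁ x.2 k + E.cκ * E.nodeCur₂ x.2 k) := by
  obtain ⟨hK1, hK2⟩ := W.Kpq_apply_eq_Kang_apply (Real.arctan (E.ρ * E.ω₀)) x.1 hk
  have hc : E.cκ = Real.cos (Real.arctan (E.ρ * E.ω₀)) := E.cκ_eq_cos_arctan
  have hs : E.sκ = Real.sin (Real.arctan (E.ρ * E.ω₀)) := E.sκ_eq_sin_arctan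
  set κ := Real.arctan (E.ρ * E.ω₀) with hκ
  set P := W.pSet κ k
  set Q := W.qSet κ k
  have hv2 : W.vref k ^ 2 ≠ 0 := pow_ne_zero 2 hk
  rw [← hK1, ← hK2, hc, hs]
  constructor
  · rw [div_eq_iff hx]
    simp only [errP, errQ, instP, instQ, DvocReduced.Kpq₁, dvocNsq]
    field_simp
    ring
  · rw [div_eq_iff hx]
    simp only [errP, errQ, instP, instQ, DvocReduced.Kpq₂, dvocNsq]
    field_simp
    ring

/-- **Powers injected with the lines at quasi-steady state and `v ∈ 𝒮`**: `v_kᵀ(𝒴v)_k =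
p_k*‖v_k‖²/v_k*²`, `v_kᵀ J(𝒴v)_k = q_k*‖v_k‖²/v_k*²` (consistent set-points at `κ = tan⁻¹(ρω₀)`;
`Consistent`, all `v_k* ≠ 0`) — from Prop. 1, `e_θ = 0` on `𝒮` and `R(κ)ᵀR(κ) = I₂`.
[cite: GrossEtAl2019, Prop. 1 with §IV-A (16)] MODELLED: model (15). -/
theorem instP_iss_of_InS (h : E.Consistent W) {v : DvocState N} (hv : W.InS v)
    (hne : ∀ k, W.vref k ≠ 0) (k : Fin N) :
    E.instP (v, E.iss v) k = W.pSet (Real.arctan (E.ρ * E.ω₀)) k * dvocNsq v k / W.vref k ^ 2 ∧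
      E.instQ (v, E.iss v) k = W.qSet (Real.arctan (E.ρ * E.ω₀)) k * dvocNsq v k / W.vref k ^ 2 := by
  have hc : E.cκ = Real.cos (Real.arctan (E.ρ * E.ω₀)) := E.cκ_eq_cos_arctan
  have hs : E.sκ = Real.sin (Real.arctan (E.ρ * E.ω₀)) := E.sκ_eq_sin_arctan
  set κ := Real.arctan (E.ρ * E.ω₀) with hκ
  obtain ⟨hK1, hK2⟩ := W.Kpq_apply_eq_Kang_apply κ v (hne k)
  obtain ⟨hL1, hL2⟩ := W.Kang_eq_lap_of_InS hv hne k
  obtain ⟨hR1, hR2⟩ := E.rot_admit v k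
  rw [← E.lap₁_eq_lineLap₁ W h, ← hL1, ← hK1] at hR1
  rw [← E.lap₂_eq_lineLap₂ W h, ← hL2, ← hK2] at hR2
  simp only [admit, nodeCur] at hR1 hR2
  have hcs := E.cκ_sq_add_sκ_sq
  set K₁ := DvocReduced.Kpq₁ κ (W.pSet κ k) (W.qSet κ k) (W.vref k) (v.1 k) (v.2 k) with hK₁
  set K₂ := DvocReduced.Kpq₂ κ (W.pSet κ k) (W.qSet κ k) (W.vref k) (v.1 k) (v.2 k) with hK₂
  have hio1 : E.nodeCur₁ (E.iss v) k = E.cκ * K₁ + E.sκ * K₂ := by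
    linear_combination E.cκ * hR1 + E.sκ * hR2 - E.nodeCur₁ (E.iss v) k * hcs
  have hio2 : E.nodeCur₂ (E.iss v) k = -E.sκ * K₁ + E.cκ * K₂ := by
    linear_combination (-E.sκ) * hR1 + E.cκ * hR2 - E.nodeCur₂ (E.iss v) k * hcs
  obtain ⟨r1, r2⟩ := DvocReduced.Kpq_readout κ (W.pSet κ k) (W.qSet κ k) (W.vref k) (v.1 k) (v.2 k)
  rw [← hc, ← hs] at r1 r2
  constructor
  · simp only [instP, dvocNsq]
    rw [hio1, hio2]
    linear_combination r1
  · simp only [instQ, dvocNsq]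
    rw [hio1, hio2]
    linear_combination r2

/-- **Objective (8) ON `𝒯`**: at every point of the target set each converter injects exactly the
prescribed powers, `p_k = p_k*`, `q_k = q_k*` («all elements of 𝒯 … satisfy all control objectives»);
`Consistent`, all `v_k* ≠ 0`. [cite: GrossEtAl2019, §II-C (8) with §IV-A (16)] MODELLED: model (15);
nothing here is a grid. -/
theorem instP_of_InT (h : E.Consistent W) (hne : ∀ k, W.vref k ≠ 0)
    {x : DvocState N × LineState M} (hx : E.InT W x) (k : Fin N) :
    E.instP x k = W.pSet (Real.arctan (E.ρ * E.ω₀)) k ∧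
      E.instQ x k = W.qSet (Real.arctan (E.ρ * E.ω₀)) k := by
  obtain ⟨hS, hA, hi⟩ := hx
  obtain ⟨h1, h2⟩ := E.instP_iss_of_InS W h hS hne k
  have hx' : x = (x.1, E.iss x.1) := Prod.ext rfl hi
  rw [hA k, mul_div_assoc, div_self (pow_ne_zero 2 (hne k)), mul_one] at h1 h2
  rw [hx']
  exact ⟨h1, h2⟩

/-- The power errors vanish on `𝒯`: `e_{p,k} = e_{q,k} = 0` there. [cite: GrossEtAl2019, §II-D (11)
with §IV-A (16)] -/
theorem errP_of_InT (h : E.Consistent W) (hne : ∀ k, W.vref k ≠ 0)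
    {x : DvocState N × LineState M} (hx : E.InT W x) (k : Fin N) :
    E.errP W x k = 0 ∧ E.errQ W x k = 0 := by
  obtain ⟨h1, h2⟩ := E.instP_of_InT W h hne hx k
  have hA := hx.2.1 k
  constructor
  · simp only [errP, h1, hA]; ring
  · simp only [errQ, h2, hA]; ring

section readouts

variable {M₀ : ℕ} (C : Fin M₀ → Fin M → ℝ)

/-- **Objective (8) along curves approaching `𝒯`**: `dist(x(t), 𝒯) → 0` implies `p_k(x(t)) → p_k*`
and `q_k(x(t)) → q_k*` at every converter (`N ≥ 1`, `Consistent`, all `v_k* ≠ 0`) — the readout lemma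
on the compact `𝒯`. [cite: GrossEtAl2019, §II-C (8) with §IV-A (16) and Thm. 2] MODELLED: model (15). -/
theorem tendsto_instP_of_tendsto_infDist_target [NeZero N] (h : E.Consistent W)
    (hv : ∀ k, W.vref k ≠ 0) {γ : ℝ → DvocState N × LineState M}
    (hT : Tendsto (fun t => infDist (γ t) (E.target W)) atTop (𝓝 0)) (k : Fin N) :
    Tendsto (fun t => E.instP (γ t) k) atTop (𝓝 (W.pSet (Real.arctan (E.ρ * E.ω₀)) k)) ∧
      Tendsto (fun t => E.instQ (γ t) k) atTop (𝓝 (W.qSet (Real.arctan (E.ρ * E.ω₀)) k)) := by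
  have hne : (E.target W).Nonempty := by
    rw [E.target_eq_image W hv]
    exact ⟨_, ⟨(1, 0), by norm_num, rfl⟩⟩
  exact ⟨tendsto_comp_of_tendsto_infDist (E.isCompact_target W hv) hne (E.continuous_instP k)
      (fun y hy => (E.instP_of_InT W h hv (show E.InT W y from hy) k).1) hT,
    tendsto_comp_of_tendsto_infDist (E.isCompact_target W hv) hne (E.continuous_instQ k)
      (fun y hy => (E.instP_of_InT W h hv (show E.InT W y from hy) k).2) hT⟩

/-- **Objective (6) and the steady-state-current objective, rotating frame, along curves approaching
`𝒯`**: `dist(x(t), 𝒯) → 0` implies `f(x(t)) → 0` — the right-hand side of (15) (`= ((d/dt)v, (d/dt)i)`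
along solutions) dies out, i.e. in the static frame `(d/dt)v_k − ω₀Jv_k → 0` and `(d/dt)i − ω₀J_M i → 0`
(`Consistent`, `ρ ≠ 0`, `‖Y_l‖ ≠ 0`, `v_k* ≠ 0`; `f` vanishes on `𝒯`, tree `fullField_eq_zero_of_InT`).
[cite: GrossEtAl2019, §II-C (6) with §IV-A (16)] MODELLED: model (15). -/
theorem tendsto_fullField_of_tendsto_infDist_target [NeZero N] (h : E.Consistent W) (hρ : E.ρ ≠ 0)
    (ha : ∀ l, E.a l ≠ 0) (hv : ∀ k, W.vref k ≠ 0) {γ : ℝ → DvocState N × LineState M}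
    (hT : Tendsto (fun t => infDist (γ t) (E.target W)) atTop (𝓝 0)) :
    Tendsto (fun t => E.fullField W (γ t)) atTop (𝓝 0) := by
  have hne : (E.target W).Nonempty := by
    rw [E.target_eq_image W hv]
    exact ⟨_, ⟨(1, 0), by norm_num, rfl⟩⟩
  exact tendsto_comp_of_tendsto_infDist (E.isCompact_target W hv) hne (E.continuous_fullField W)
    (fun y hy => E.fullField_eq_zero_of_InT W h hρ ha hv (show E.InT W y from hy)) hT

/-- Rotating-frame ANGULAR-VELOCITY DEVIATION of converter `k`: `(v_k × f_{v,k}(x))/‖v_k‖²` — along a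
solution of (15) this is `(v_k × v̇_k)/‖v_k‖²`, the instantaneous angular frequency of the voltage
vector `v_k` minus `ω₀` (objective (6) ⟺ it vanishes). [cite: GrossEtAl2019, §II-C (6)]
MODELLED: model (15). -/
def freqDev (x : DvocState N × LineState M) (k : Fin N) : ℝ :=
  (x.1.1 k * (E.fvVec W x.1 x.2).2 k - x.1.2 k * (E.fvVec W x.1 x.2).1 k) / dvocNsq x.1 k

/-- **Objective (6) as a frequency statement along curves approaching `𝒯`**: the angular-velocity
deviation `(v_k × v̇_k)/‖v_k‖² → 0` at every converter, i.e. every terminal voltage asymptotically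
rotates at the synchronous frequency `ω₀` (numerator `→ 0` by `f → 0` and bounded `v`, denominator
`‖v_k‖² → v_k*² ≠ 0`). [cite: GrossEtAl2019, §II-C (6) with §IV-A (16)] MODELLED: model (15). -/
theorem tendsto_freqDev_of_tendsto_infDist_target [NeZero N] (h : E.Consistent W) (hρ : E.ρ ≠ 0)
    (ha : ∀ l, E.a l ≠ 0) (hv : ∀ k, W.vref k ≠ 0) {γ : ℝ → DvocState N × LineState M}
    (hT : Tendsto (fun t => infDist (γ t) (E.target W)) atTop (𝓝 0)) (k : Fin N) :
    Tendsto (fun t => E.freqDev W (γ t) k) atTop (𝓝 0) := by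
  have hne : (E.target W).Nonempty := by
    rw [E.target_eq_image W hv]
    exact ⟨_, ⟨(1, 0), by norm_num, rfl⟩⟩
  -- the numerator is a continuous readout vanishing on `𝒯`
  have hnum : Tendsto (fun t => (γ t).1.1 k * (E.fvVec W (γ t).1 (γ t).2).2 k
      - (γ t).1.2 k * (E.fvVec W (γ t).1 (γ t).2).1 k) atTop (𝓝 0) := by
    have hcont : Continuous fun x : DvocState N × LineState M =>
        x.1.1 k * (E.fvVec W x.1 x.2).2 k - x.1.2 k * (E.fvVec W x.1 x.2).1 k := by
      unfold fvVec fv₁ fv₂ DvocReduced.Kang₁ DvocReduced.Kang₂ DvocReduced.Phi dvocNsq nodeCur₁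
        nodeCur₂
      fun_prop
    refine tendsto_comp_of_tendsto_infDist (E.isCompact_target W hv) hne hcont (fun y hy => ?_) hT
    have hf := E.fullField_eq_zero_of_InT W h hρ ha hv (show E.InT W y from hy)
    have h1 : (E.fvVec W y.1 y.2).1 k = 0 := by
      have := congrArg (fun z : DvocState N × LineState M => z.1.1 k) hf
      simpa [fullField] using this
    have h2 : (E.fvVec W y.1 y.2).2 k = 0 := by
      have := congrArg (fun z : DvocState N × LineState M => z.1.2 k) hf
      simpa [fullField] using this
    rw [h1, h2]; ring
  have hden := E.tendsto_nsq_of_tendsto_infDist_target W hv hT k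
  have hdiv := hnum.div hden (pow_ne_zero 2 (hv k))
  rw [zero_div] at hdiv
  exact hdiv.congr fun _ => rfl

/-- **Theorem 2 in the words of ALL FOUR control objectives of §II-C**: under the hypotheses of
`thm2_dichotomy`, EVERY solution of the full-order model (15) on `[0, ∞)` either tends to `0ₙ`
(voltage collapse — the print's measure-zero exception, untyped) or, asymptotically, (6) rotates every
terminal voltage at the synchronous frequency (`(v_k × v̇_k)/‖v_k‖² → 0` in the `ω₀`-frame) with the
whole right-hand side of (15) dying out, (7) regulates every amplitude `‖v_k(t)‖² → v_k*²`, (8) injects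
the prescribed powers `p_k(t) → p_k*`, `q_k(t) → q_k*` at every converter, and synchronises the phases
`‖v(t)‖²_S → 0` with the line currents locked on `i(t) − i^s(v(t)) → 0`. [cite: GrossEtAl2019, Thm. 2
with §II-C (6)–(8) and §IV-A (16)] MODELLED: model (15) (classes as in `thm2_dichotomy`); nothing here
is a grid, and no declaration says «stable». -/
theorem thm2_powerInjection [NeZero N] (h : E.Consistent W) (hρ : 0 < E.ρ) (ha : ∀ l, 0 < E.a l)
    (hη : 0 < W.η) (hα : 0 < W.α) (hv : ∀ k, 0 < W.vref k) {c κ₀ Υ : ℝ} (hc : 0 < c) (hκ₀ : 0 < κ₀)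
    (hcκ : c ≤ κ₀) (hΥ : 0 < Υ) (h23 : W.DecreaseOnS c) (hK : W.PhaseErrorBound κ₀)
    (hY : E.AdmittanceBound Υ) (h35 : W.η < c / (E.ρ * Υ * (c + 5 * κ₀)))
    {γ : ℝ → DvocState N × LineState M} (hsol : E.IsSolutionOn W γ (Ici 0)) :
    Tendsto γ atTop (𝓝 0) ∨
      ((∀ k, Tendsto (fun t => E.freqDev W (γ t) k) atTop (𝓝 0)) ∧
        Tendsto (fun t => E.fullField W (γ t)) atTop (𝓝 0) ∧
        (∀ k, Tendsto (fun t => dvocNsq (γ t).1 k) atTop (𝓝 (W.vref k ^ 2))) ∧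
        (∀ k, Tendsto (fun t => E.instP (γ t) k) atTop (𝓝 (W.pSet (Real.arctan (E.ρ * E.ω₀)) k)) ∧
          Tendsto (fun t => E.instQ (γ t) k) atTop (𝓝 (W.qSet (Real.arctan (E.ρ * E.ω₀)) k))) ∧
        Tendsto (fun t => W.normS2 (γ t).1) atTop (𝓝 0) ∧
        Tendsto (fun t => E.dev (γ t).1 (γ t).2) atTop (𝓝 0)) := by
  have hv' : ∀ k, W.vref k ≠ 0 := fun k => (hv k).ne'
  have ha' : ∀ l, E.a l ≠ 0 := fun l => (ha l).ne'
  rcases E.thm2_dichotomy W h hρ ha hη hα hv hc hκ₀ hcκ hΥ h23 hK hY h35 hsol with hT | h0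
  · right
    exact ⟨fun k => E.tendsto_freqDev_of_tendsto_infDist_target W h hρ.ne' ha' hv' hT k,
      E.tendsto_fullField_of_tendsto_infDist_target W h hρ.ne' ha' hv' hT,
      fun k => E.tendsto_nsq_of_tendsto_infDist_target W hv' hT k,
      fun k => E.tendsto_instP_of_tendsto_infDist_target W h hv' hT k,
      E.thm2_tendsto_normS2 W h hρ ha hη hα hv hc hκ₀ hcκ hΥ h23 hK hY h35 hsol,
      E.thm2_tendsto_dev W h hρ ha hη hα hv hc hκ₀ hcκ hΥ h23 hK hY h35 hsol⟩
  · exact Or.inl h0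

end readouts

end DvocLines

end Literature.MathematicalPhysics.PowerSystems
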